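import Literature.Computability.MetaComplexity.HoloCosetCover
import HarnessLib

/-!
# Fourier tests on a parity coset of the Boolean cube inside `(ℤ/3)^z`: vanishing, sign vectors, and
# the rigidity of sparse holomorphic character sums (`SparseKappa`)

**Sources.** D. A. Mix Barrington, H. Straubing, D. Thérien, *Non-uniform automata over groups*,
Inform. and Comput. 89 (1990) 109–132, §6 pp. 122–124: the product functions `Q_w(u) = ω^{⟨w,u⟩}` on
`{0,1}ⁿ`, `Q_v · Q_w = Q_{v+w}`, and the uncertainty principle `supp(f)·weight(f) ≥ kⁿ` for
combinations of the `P_w` [BarringtonStraubingTherien1990]; R. Meshulam, *On subsets of finite abelian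
groups with no 3-term arithmetic progressions*, J. Combin. Theory Ser. A 71 (1995) 168–172 (Fourier
analysis on `𝔽₃ⁿ`; context only) [Meshulam1995].

**What is proved (all proved, no named facts).**  Field `F` of characteristic `2`, `ω ∈ F` with
`ω² + ω + 1 = 0`; `Q_y = HoloCoset.cubeChar ω y`; `H_ε = ParityModTestDensity.parityCoset z ε`;
the COSET CHARACTER SUM `Ŝ_ε(y) = Σ_{u ∈ H_ε} Q_y(u)` (`cosetCharSum`).

* `cosetCharSum_eq_zero_of_two_zeros` (**(V)**, `P-38e.1`) — if `y_i = y_j = 0` for some `i ≠ j`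
  then `Ŝ_ε(y) = 0` (the flip `u ↦ u ⊕ e_i ⊕ e_j` is a fixed-point-free involution of `H_ε` preserving
  `⟨y,u⟩`; characteristic `2`).
* `cosetCharSum_true_eq` / `cosetCharSum_false_eq` and `cosetCharSum_ne_zero` (**(N)**, `P-38e.2`) —
  for a SIGN vector `v ∈ {1,2}^z` with `n₁ = #{v_i = 1}`, `n₂ = #{v_i = 2}` and `P = ∏_i ω^{v_i}`:
  `Ŝ₁(v) = P²(n₁ω² + n₂ω)`, `Ŝ₀(v) = P²(1 + n₁ω² + n₂ω)`; hence `Ŝ_ε(v) ≠ 0` whenever `z` is odd, or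
  `z` is even and `n₁ ≡ ε (mod 2)` (no induction on `z`: the odd-coset sum is `Σ_u |u|·Q_v(u)`, and
  `1 + ω^k = ω^{2k}` for `k ≠ 0`).
* `sum_coset_cubeChar_mul_holoSum` (**(O)** orthogonality) — if `R = Σ_g a_g Q_{w_g} ≡ κ` on `H_ε`
  then `Σ_g a_g Ŝ_ε(v + w_g) = κ·Ŝ_ε(v)` for every `v`.
* (private counting) the sign patterns agreeing with a fixed pattern in at most one point of a set `S`
  number `≤ (|S|+1)·2^{z−|S|}`; at least half of the patterns lie in any parity class.
* `sparseKappa` (**`P-38e`**, typed `AffBells35.SparseKappa` verbatim) — if every term has coin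
  support `≥ K`, `2m(K+1) < 2^K` and `z ≥ 1`, then `κ = 0`.
* `holoIsolation` (**`P-38b′`**, typed `AffBells35.HoloIsolation` verbatim, binder `3 ≤ D`) — every
  exponent vector with non-zero merged coefficient and support `≥ D` has another one with non-zero
  merged coefficient at Hamming distance `< D`, once `8mD < 2^D`.
* `silenceOfLocal` (**`P-38j`**, typed `AffBells35.SilenceOfLocal` verbatim) — an aggregate of wide far
  forms times local forms that depends only on the local assignment vanishes (corollary of `sparseKappa`).
* `wout`, `scaleIsolation` (**`P-38k`**, typed `AffBells35.ScaleIsolation` verbatim) — with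
  `2m(D+1) < 2^D` and `|supp w_b| ≥ 3`, a partner with non-zero merged coefficient sticks out of
  `supp w_b` by `< D` coordinates.

These forms are not located in print (the printed relatives are BST90's uncertainty principle and
the Fourier analysis of `{0,1}ⁿ ⊂ 𝔽₃ⁿ` of the cap-set literature) and are supplied here (consumer: cell
qa-qnc0, ROUND-34 §11.4, definitions `wsupp`/`cosetCharSum`/`hdist` repeated VERBATIM from
`exp35/Sketch35.lean` §4 so that the typed targets port by `exact`).
-/

noncomputable section

namespace Literature.Computability.MetaComplexity

namespace CosetFourier

open Finset ParityModTestDensity HoloCoset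

variable {F : Type*} [Field F] {z m : ℕ}

/-! ### 1. The objects (verbatim `exp35/Sketch35.lean` §4) -/

/-- Coin support of an exponent vector `w ∈ 𝔽₃^z`. [cite: BarringtonStraubingTherien1990, §6 (supp); supplied here] -/
def wsupp (w : Fin z → ZMod 3) : Finset (Fin z) := univ.filter fun i => w i ≠ 0

/-- The parity-coset character sum `Ŝ_ε(y) = Σ_{u ∈ H_ε} ω^{⟨y,u⟩}`.
[cite: BarringtonStraubingTherien1990, §6 (sums of the Q_w over sub-cubes); coset form supplied here] -/
def cosetCharSum (ω : F) (z : ℕ) (ε : Bool) (y : Fin z → ZMod 3) : F :=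
  ∑ u ∈ parityCoset z ε, cubeChar ω y u

/-- Hamming distance of exponent vectors. [cite: BarringtonStraubingTherien1990, §6; supplied here] -/
def hdist (w w' : Fin z → ZMod 3) : ℕ := (univ.filter fun i => w i ≠ w' i).card

/-! ### 2. Character algebra -/

section Algebra

variable [CharP F 2] {ω : F}

/-- `ω³ = 1`. [folklore] -/
private theorem omega_pow_three (hω : ω ^ 2 + ω + 1 = 0) : ω ^ 3 = 1 := by
  have h2 : (2 : F) = 0 := CharTwo.two_eq_zero
  linear_combination (ω + 1) * hω - (ω ^ 2 + ω + 1) * h2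

omit [CharP F 2] in
/-- `ω ≠ 0`. [folklore] -/
private theorem omega_ne_zero (hω : ω ^ 2 + ω + 1 = 0) : ω ≠ 0 := by
  intro h; rw [h] at hω; simp at hω

/-- `1 + ω^{k} = ω^{2k}` for `k ∈ {1,2}`, i.e. `1 + χ(k) = χ(k)²` for `k ≠ 0`. [folklore] -/
private theorem one_add_chi_eq_sq (hω : ω ^ 2 + ω + 1 = 0) {k : ZMod 3} (hk : k ≠ 0) :
    1 + ω ^ k.val = (ω ^ k.val) ^ 2 := by
  have h2 : (2 : F) = 0 := CharTwo.two_eq_zero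
  have h3 := omega_pow_three hω
  have hval : k.val = 1 ∨ k.val = 2 := by
    have := k.val_lt; have h0 : k.val ≠ 0 := fun h0 => hk ((ZMod.val_eq_zero k).1 h0); omega
  rcases hval with hv | hv
  · rw [hv, pow_one]; linear_combination -hω + h2 * ω + h2
  · rw [hv]
    have h4 : (ω ^ 2) ^ 2 = ω := by
      rw [← pow_mul, show 2 * 2 = 3 + 1 by norm_num, pow_add, h3, one_mul, pow_one]
    rw [h4]; linear_combination hω - h2 * ω

/-- `(ω^k)³ = 1`. [folklore] -/
private theorem chi_pow_three (hω : ω ^ 2 + ω + 1 = 0) (k : ZMod 3) : (ω ^ k.val) ^ 3 = 1 := by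
  rw [← pow_mul, mul_comm, pow_mul, omega_pow_three hω, one_pow]

/-- The exponent `⟨y,u⟩` as a linear form. [cite: BarringtonStraubingTherien1990, §6] -/
private theorem lin_add (y y' : Fin z → ZMod 3) (u : Fin z → Bool) :
    (∑ i, if u i then (y + y') i else (0 : ZMod 3))
      = (∑ i, if u i then y i else 0) + ∑ i, if u i then y' i else 0 := by
  rw [← sum_add_distrib]
  exact sum_congr rfl fun i _ => by split_ifs <;> simp

omit [CharP F 2] in
/-- **Multiplicativity** `Q_y · Q_{y'} = Q_{y+y'}`. [cite: BarringtonStraubingTherien1990, §6 (Q_v Q_w = Q_{vw}, p. 124)] -/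
theorem cubeChar_mul (h3 : ω ^ 3 = 1) (y y' : Fin z → ZMod 3) (u : Fin z → Bool) :
    cubeChar ω y u * cubeChar ω y' u = cubeChar ω (y + y') u := by
  unfold cubeChar
  rw [lin_add, ← pow_add, ZMod.val_add, ← pow_eq_pow_mod _ h3]

omit [CharP F 2] in
/-- `Q_y(u) = ∏_i (u_i ? ω^{y_i} : 1)`. [cite: BarringtonStraubingTherien1990, §6 (Q_w(u) = ∏ w_i^{u_i})] -/
theorem cubeChar_eq_prod (h3 : ω ^ 3 = 1) (y : Fin z → ZMod 3) (u : Fin z → Bool) :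
    cubeChar ω y u = ∏ i, (if u i then ω ^ (y i).val else 1) := by
  classical
  unfold cubeChar
  -- peel the sum coordinate by coordinate via `Finset.prod_pow_eq_pow_sum`-type bookkeeping
  have key : ∀ s : Finset (Fin z), ω ^ (∑ i ∈ s, if u i then y i else (0 : ZMod 3)).val
      = ∏ i ∈ s, (if u i then ω ^ (y i).val else 1) := by
    intro s
    induction s using Finset.induction_on with
    | empty => simp
    | insert a s ha ih =>
        rw [sum_insert ha, prod_insert ha, ZMod.val_add, ← pow_eq_pow_mod _ h3, pow_add, ih]
        congr 1
        split_ifs <;> simp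
  exact key univ

end Algebra

/-! ### 3. (V) Vanishing: two zero coordinates kill the coset sum -/

/-- Toggle one coordinate. [folklore] -/
private def toggle (u : Fin z → Bool) (i : Fin z) : Fin z → Bool := Function.update u i (!u i)

omit [Field F] in
/-- Value of a toggle at the toggled coordinate. [folklore] -/
private theorem toggle_apply_self (u : Fin z → Bool) (i : Fin z) : toggle u i i = !u i := by
  simp [toggle]

omit [Field F] in
/-- Value of a toggle elsewhere. [folklore] -/
private theorem toggle_apply_ne (u : Fin z → Bool) {i k : Fin z} (h : k ≠ i) : toggle u i k = u k := by
  simp [toggle, h]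

omit [Field F] in
/-- Toggling one coordinate flips the parity of the number of ones. [folklore] -/
private theorem odd_onesCard_toggle (u : Fin z → Bool) (i : Fin z) :
    Odd (onesCard (toggle u i)) ↔ ¬ Odd (onesCard u) := by
  classical
  unfold onesCard
  by_cases hi : u i = true
  · -- ones' = ones.erase i
    have hset : (univ.filter fun k => toggle u i k = true) = (univ.filter fun k => u k = true).erase i := by
      ext k
      by_cases hk : k = i
      · subst hk; simp [toggle_apply_self, hi]
      · simp [toggle_apply_ne u hk, hk]
    have hmem : i ∈ univ.filter fun k => u k = true := by simp [hi]
    rw [hset, card_erase_of_mem hmem]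
    have hpos := card_pos.2 ⟨i, hmem⟩
    rcases Nat.even_or_odd (univ.filter fun k => u k = true).card with he | ho
    · constructor
      · intro _ ho'; exact (Nat.not_even_iff_odd.2 ho') he
      · intro _
        obtain ⟨r, hr⟩ := he
        exact ⟨r - 1, by omega⟩
    · constructor
      · intro ho'
        obtain ⟨r, hr⟩ := ho; obtain ⟨r', hr'⟩ := ho'
        omega
      · intro h; exact absurd ho h
  · have hi' : u i = false := by simpa using hi
    have hset : (univ.filter fun k => toggle u i k = true) = insert i (univ.filter fun k => u k = true) := by
      ext k
      by_cases hk : k = i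
      · subst hk; simp [toggle_apply_self, hi']
      · simp [toggle_apply_ne u hk, hk]
    have hnot : i ∉ univ.filter fun k => u k = true := by simp [hi']
    rw [hset, card_insert_of_notMem hnot]
    rcases Nat.even_or_odd (univ.filter fun k => u k = true).card with he | ho
    · constructor
      · intro _ ho'; exact (Nat.not_even_iff_odd.2 ho') he
      · intro _; obtain ⟨r, hr⟩ := he; exact ⟨r, by omega⟩
    · constructor
      · intro ho'; obtain ⟨r, hr⟩ := ho; obtain ⟨r', hr'⟩ := ho'; omega
      · intro h; exact absurd ho h

omit [Field F] in
/-- Membership in a parity coset is a statement about the parity of the number of ones. [folklore] -/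
private theorem mem_parityCoset (ε : Bool) (u : Fin z → Bool) :
    u ∈ parityCoset z ε ↔ decide (Odd (onesCard u)) = ε := by
  unfold parityCoset onesCard; simp

/-- **(V) VANISHING LEMMA (`P-38e.1`).**  If `y` has two zero coordinates `i ≠ j`, then `Ŝ_ε(y) = 0`:
the flip `u ↦ u ⊕ e_i ⊕ e_j` is a fixed-point-free involution of `H_ε` preserving `⟨y,u⟩`, so in
characteristic `2` the summands cancel in pairs.
[cite: BarringtonStraubingTherien1990, §6; coset vanishing supplied here (qa-qnc0 ROUND-34 §11.4 (V))] -/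
theorem cosetCharSum_eq_zero_of_two_zeros [CharP F 2] (ω : F) (ε : Bool) (y : Fin z → ZMod 3)
    {i j : Fin z} (hij : i ≠ j) (hi : y i = 0) (hj : y j = 0) : cosetCharSum ω z ε y = 0 := by
  classical
  unfold cosetCharSum
  -- the involution
  let g : (Fin z → Bool) → Fin z → Bool := fun u => toggle (toggle u i) j
  have hg_apply : ∀ u k, g u k = if k = i ∨ k = j then !u k else u k := by
    intro u k
    by_cases hkj : k = j
    · subst hkj
      simp only [g, toggle_apply_self, toggle_apply_ne _ hij.symm, or_true, ↓reduceIte]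
    · by_cases hki : k = i
      · subst hki
        simp only [g, toggle_apply_ne _ hkj, toggle_apply_self, true_or, ↓reduceIte]
      · simp only [g, toggle_apply_ne _ hkj, toggle_apply_ne _ hki, hki, hkj, or_self, ↓reduceIte]
  have hg_inv : ∀ u, g (g u) = u := by
    intro u; funext k; rw [hg_apply, hg_apply]; split_ifs <;> simp
  have hg_mem : ∀ u ∈ parityCoset z ε, g u ∈ parityCoset z ε := by
    intro u hu
    rw [mem_parityCoset] at hu ⊢
    have h1 : Odd (onesCard (g u)) ↔ Odd (onesCard u) := by
      show Odd (onesCard (toggle (toggle u i) j)) ↔ _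
      rw [odd_onesCard_toggle, odd_onesCard_toggle, not_not]
    rw [← hu]
    by_cases ho : Odd (onesCard u) <;> simp [ho, h1]
  have hg_val : ∀ u, cubeChar ω y (g u) = cubeChar ω y u := by
    intro u
    unfold cubeChar
    congr 2
    refine sum_congr rfl fun k _ => ?_
    rw [hg_apply]
    by_cases hk : k = i ∨ k = j
    · rcases hk with rfl | rfl
      · simp [hi]
      · simp [hj]
    · rw [if_neg hk]
  have hg_ne : ∀ u, g u ≠ u := by
    intro u h
    have := congrFun h i
    rw [hg_apply, if_pos (Or.inl rfl)] at this
    cases hu : u i <;> simp [hu] at this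
  refine Finset.sum_involution (fun u _ => g u) (fun u _ => ?_) (fun u _ _ => hg_ne u)
    (fun u hu => hg_mem u hu) (fun u _ => hg_inv u)
  rw [hg_val, CharTwo.add_self_eq_zero]

/-! ### 4. (N) Sign vectors: closed forms for `Ŝ₀`, `Ŝ₁` and non-vanishing -/

section Sign

variable [CharP F 2] {ω : F}

omit [CharP F 2] in
/-- The full cube sum of a character is a product: `Σ_u Q_v(u) = ∏_i (1 + ω^{v_i})`.
[cite: BarringtonStraubingTherien1990, §6 (Th₁ computation, p. 124); supplied here] -/
theorem sum_cubeChar_eq_prod (h3 : ω ^ 3 = 1) (v : Fin z → ZMod 3) :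
    ∑ u : Fin z → Bool, cubeChar ω v u = ∏ i, (1 + ω ^ (v i).val) := by
  classical
  simp_rw [cubeChar_eq_prod h3]
  rw [← Fintype.piFinset_univ, ← Finset.prod_univ_sum (fun _ => (univ : Finset Bool))
    (fun i b => if b then ω ^ (v i).val else 1)]
  refine prod_congr rfl fun i _ => ?_
  rw [Fintype.sum_bool]; simp [add_comm]

omit [CharP F 2] in
/-- The ONES-weighted cube sum: `Σ_u |u|·Q_v(u) = Σ_i ω^{v_i} ∏_{k≠i}(1 + ω^{v_k})`.
[cite: BarringtonStraubingTherien1990, §6; supplied here] -/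
theorem sum_onesCard_mul_cubeChar_eq (h3 : ω ^ 3 = 1) (v : Fin z → ZMod 3) :
    ∑ u : Fin z → Bool, (onesCard u : F) * cubeChar ω v u
      = ∑ i, ω ^ (v i).val * ∏ k ∈ univ.erase i, (1 + ω ^ (v k).val) := by
  classical
  have hcast : ∀ u : Fin z → Bool, (onesCard u : F) = ∑ i, if u i then (1 : F) else 0 := by
    intro u; unfold onesCard; rw [Finset.natCast_card_filter]
  simp_rw [hcast, Finset.sum_mul]
  rw [Finset.sum_comm]
  refine sum_congr rfl fun i _ => ?_
  -- Σ_u [u_i] Q_v(u) = ∏_k (g'_k 0 + g'_k 1) with the i-th factor pinned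
  let f : Fin z → Bool → F := fun k b => if k = i then (if b then ω ^ (v k).val else 0)
    else (if b then ω ^ (v k).val else 1)
  have hterm : ∀ u : Fin z → Bool, (if u i then (1 : F) else 0) * cubeChar ω v u = ∏ k, f k (u k) := by
    intro u
    rw [cubeChar_eq_prod h3, ← Finset.mul_prod_erase univ _ (mem_univ i),
      ← Finset.mul_prod_erase univ (fun k => f k (u k)) (mem_univ i), ← mul_assoc]
    congr 1
    · simp only [f, if_true]; cases u i <;> simp
    · exact prod_congr rfl fun k hk => by simp only [f, if_neg (ne_of_mem_erase hk)]
  simp_rw [hterm]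
  rw [← Fintype.piFinset_univ, ← Finset.prod_univ_sum (fun _ => (univ : Finset Bool)) f,
    ← Finset.mul_prod_erase univ _ (mem_univ i)]
  congr 1
  · rw [Fintype.sum_bool]; simp [f]
  · exact prod_congr rfl fun k hk => by
      rw [Fintype.sum_bool]; simp [f, if_neg (ne_of_mem_erase hk), add_comm]

/-- The odd-coset sum is the ones-weighted sum: `Ŝ₁(v) = Σ_u |u|·Q_v(u)` (characteristic 2).
[cite: BarringtonStraubingTherien1990, §6; supplied here] -/
theorem cosetCharSum_true_eq_sum (v : Fin z → ZMod 3) :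
    cosetCharSum ω z true v = ∑ u : Fin z → Bool, (onesCard u : F) * cubeChar ω v u := by
  classical
  unfold cosetCharSum
  have hcast : ∀ u : Fin z → Bool, (onesCard u : F) = if Odd (onesCard u) then 1 else 0 := by
    intro u
    have h2 : (2 : F) = 0 := CharTwo.two_eq_zero
    rcases Nat.even_or_odd (onesCard u) with he | ho
    · rw [if_neg (Nat.not_odd_iff_even.2 he)]
      obtain ⟨r, hr⟩ := he
      rw [hr]; push_cast
      linear_combination (r : F) * h2
    · rw [if_pos ho]
      obtain ⟨r, hr⟩ := ho
      rw [hr]; push_cast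
      linear_combination (r : F) * h2
  simp_rw [hcast, ite_mul, one_mul, zero_mul]
  rw [← Finset.sum_filter]
  refine sum_congr ?_ fun _ _ => rfl
  ext u; rw [mem_parityCoset]; simp

omit [CharP F 2] in
/-- The two cosets partition the cube: `Ŝ₀(v) + Ŝ₁(v) = Σ_u Q_v(u)`.
[cite: BarringtonStraubingTherien1990, §6; supplied here] -/
theorem cosetCharSum_false_add_true (v : Fin z → ZMod 3) :
    cosetCharSum ω z false v + cosetCharSum ω z true v = ∑ u : Fin z → Bool, cubeChar ω v u := by
  classical
  unfold cosetCharSum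
  have hf : parityCoset z false = univ.filter fun u => ¬ (decide (Odd (onesCard u)) = true) := by
    ext u; rw [mem_parityCoset]; simp
  have ht : parityCoset z true = univ.filter fun u => decide (Odd (onesCard u)) = true := by
    ext u; rw [mem_parityCoset]; simp
  rw [hf, ht, add_comm, Finset.sum_filter_add_sum_filter_not]

/-- `n₁ + n₂ = z` for a sign vector. [folklore] -/
private theorem card_one_add_card_two {v : Fin z → ZMod 3} (hv : ∀ i, v i ≠ 0) :
    (univ.filter fun i => v i = 1).card + (univ.filter fun i => v i = 2).card = z := by
  classical
  have hdisj : Disjoint (univ.filter fun i => v i = 1) (univ.filter fun i => v i = 2) := by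
    rw [Finset.disjoint_filter]; intro i _ h1 h2; rw [h1] at h2; exact absurd h2 (by decide)
  have hunion : (univ.filter fun i => v i = 1) ∪ (univ.filter fun i => v i = 2) = univ := by
    ext i
    simp only [mem_union, mem_filter, mem_univ, true_and, iff_true]
    have := hv i
    have : (v i).val = 1 ∨ (v i).val = 2 := by
      have hl := (v i).val_lt
      have h0 : (v i).val ≠ 0 := fun h0 => this ((ZMod.val_eq_zero _).1 h0)
      omega
    rcases this with h | h
    · left; exact (ZMod.val_injective 3 (by rw [h]; rfl))
    · right; exact (ZMod.val_injective 3 (by rw [h]; rfl))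
  rw [← card_union_of_disjoint hdisj, hunion, card_univ, Fintype.card_fin]

/-- `Σ_i ω^{2 v_i} = n₁ω² + n₂ω` for a sign vector. [folklore] -/
private theorem sum_chi_sq (hω : ω ^ 2 + ω + 1 = 0) {v : Fin z → ZMod 3} (hv : ∀ i, v i ≠ 0) :
    ∑ i, (ω ^ (v i).val) ^ 2
      = ((univ.filter fun i => v i = 1).card : F) * ω ^ 2 + ((univ.filter fun i => v i = 2).card : F) * ω := by
  classical
  have h3 := omega_pow_three hω
  rw [← Finset.sum_filter_add_sum_filter_not univ (fun i => v i = 1)]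
  have hnot : univ.filter (fun i => ¬ v i = 1) = univ.filter (fun i => v i = 2) := by
    ext i
    simp only [mem_filter, mem_univ, true_and]
    have hvi := hv i
    have : (v i).val = 1 ∨ (v i).val = 2 := by
      have hl := (v i).val_lt
      have h0 : (v i).val ≠ 0 := fun h0 => hvi ((ZMod.val_eq_zero _).1 h0)
      omega
    constructor
    · intro h1
      rcases this with h | h
      · exact absurd (ZMod.val_injective 3 (by rw [h]; rfl)) h1
      · exact ZMod.val_injective 3 (by rw [h]; rfl)
    · intro h2; rw [h2]; decide
  rw [hnot]
  have e1 : ∑ i ∈ univ.filter (fun i => v i = 1), (ω ^ (v i).val) ^ 2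
      = ((univ.filter fun i => v i = 1).card : F) * ω ^ 2 := by
    rw [sum_congr rfl fun i hi => by rw [(mem_filter.1 hi).2], sum_const, nsmul_eq_mul]
    congr 1
    show (ω ^ (1 : ZMod 3).val) ^ 2 = ω ^ 2
    rw [show (1 : ZMod 3).val = 1 from rfl, pow_one]
  have e2 : ∑ i ∈ univ.filter (fun i => v i = 2), (ω ^ (v i).val) ^ 2
      = ((univ.filter fun i => v i = 2).card : F) * ω := by
    rw [sum_congr rfl fun i hi => by rw [(mem_filter.1 hi).2], sum_const, nsmul_eq_mul]
    congr 1
    show (ω ^ (2 : ZMod 3).val) ^ 2 = ω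
    rw [show (2 : ZMod 3).val = 2 from rfl, ← pow_mul, show 2 * 2 = 3 + 1 by norm_num, pow_add, h3,
      one_mul, pow_one]
  rw [e1, e2]

/-- **Closed form of the ODD-coset sum on a sign vector**: `Ŝ₁(v) = P²·(n₁ω² + n₂ω)`, `P = ∏_i ω^{v_i}`.
[cite: BarringtonStraubingTherien1990, §6; supplied here (qa-qnc0 ROUND-34 §11.4 (N))] -/
theorem cosetCharSum_true_eq (hω : ω ^ 2 + ω + 1 = 0) {v : Fin z → ZMod 3} (hv : ∀ i, v i ≠ 0) :
    cosetCharSum ω z true v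
      = (∏ i, ω ^ (v i).val) ^ 2 *
        (((univ.filter fun i => v i = 1).card : F) * ω ^ 2 + ((univ.filter fun i => v i = 2).card : F) * ω) := by
  classical
  have h3 := omega_pow_three hω
  rw [cosetCharSum_true_eq_sum, sum_onesCard_mul_cubeChar_eq h3, ← sum_chi_sq hω hv, Finset.mul_sum]
  refine sum_congr rfl fun i _ => ?_
  -- ω^{v_i} ∏_{k≠i} (1+ω^{v_k}) = ω^{v_i} ∏_{k≠i} ω^{2v_k} = P² ω^{v_i} / ω^{2 v_i} = P² ω^{2 v_i}
  rw [prod_congr rfl fun k _ => one_add_chi_eq_sq hω (hv k), Finset.prod_pow,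
    ← Finset.mul_prod_erase univ (fun k => ω ^ (v k).val) (mem_univ i)]
  set P' := ∏ k ∈ univ.erase i, ω ^ (v k).val
  have hc3 := chi_pow_three hω (v i)
  -- ω^{v_i} P'^2 = (ω^{v_i} P')^2 ω^{2v_i}  since  (ω^{v_i})^3 = 1
  linear_combination (-(P' ^ 2 * ω ^ (v i).val)) * hc3

/-- **Closed form of the EVEN-coset sum on a sign vector**: `Ŝ₀(v) = P²·(1 + n₁ω² + n₂ω)`.
[cite: BarringtonStraubingTherien1990, §6; supplied here (qa-qnc0 ROUND-34 §11.4 (N))] -/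
theorem cosetCharSum_false_eq (hω : ω ^ 2 + ω + 1 = 0) {v : Fin z → ZMod 3} (hv : ∀ i, v i ≠ 0) :
    cosetCharSum ω z false v
      = (∏ i, ω ^ (v i).val) ^ 2 *
        (1 + ((univ.filter fun i => v i = 1).card : F) * ω ^ 2 + ((univ.filter fun i => v i = 2).card : F) * ω) := by
  have h2 : (2 : F) = 0 := CharTwo.two_eq_zero
  have h3 := omega_pow_three hω
  have hsum := cosetCharSum_false_add_true (ω := ω) v
  rw [sum_cubeChar_eq_prod h3, prod_congr rfl fun k _ => one_add_chi_eq_sq hω (hv k), Finset.prod_pow,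
    cosetCharSum_true_eq hω hv] at hsum
  set P := ∏ i, ω ^ (v i).val
  set A := ((univ.filter fun i => v i = 1).card : F) * ω ^ 2 + ((univ.filter fun i => v i = 2).card : F) * ω
  linear_combination hsum - (P ^ 2 * A) * h2

/-- **(N) NON-VANISHING ON SIGN VECTORS (`P-38e.2`, typed `AffBells35.CosetCharSumSign` verbatim).**
For `v ∈ {1,2}^z`, `z > 0`: `Ŝ_ε(v) ≠ 0` whenever `z` is odd, or `n₁(v) ≡ ε (mod 2)`.
[cite: BarringtonStraubingTherien1990, §6; supplied here (qa-qnc0 ROUND-34 §11.4 (N))] -/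
theorem cosetCharSum_ne_zero (hω : ω ^ 2 + ω + 1 = 0) (ε : Bool) (v : Fin z → ZMod 3)
    (_hz : 0 < z) (hv : ∀ i, v i ≠ 0)
    (hpar : Odd z ∨ ((univ.filter fun i => v i = 1).card % 2 = if ε then 1 else 0)) :
    cosetCharSum ω z ε v ≠ 0 := by
  classical
  have h2 : (2 : F) = 0 := CharTwo.two_eq_zero
  have hω0 := omega_ne_zero hω
  have hP : (∏ i, ω ^ (v i).val) ^ 2 ≠ 0 := pow_ne_zero _ (prod_ne_zero_iff.2 fun i _ => pow_ne_zero _ hω0)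
  -- casts of n₁, n₂ are their parities
  set n₁ := (univ.filter fun i => v i = 1).card with hn₁
  set n₂ := (univ.filter fun i => v i = 2).card with hn₂
  have hz12 : n₁ + n₂ = z := card_one_add_card_two hv
  have cast_eq : ∀ n : ℕ, (n : F) = if n % 2 = 1 then 1 else 0 := fun n => by
    conv_lhs => rw [← Nat.div_add_mod n 2]
    push_cast; rw [h2]
    split_ifs with h
    · rw [h]; simp
    · have h' : n % 2 = 0 := by omega
      rw [h']; simp
  -- useful non-vanishing facts
  have hω2 : ω ^ 2 ≠ 0 := pow_ne_zero _ hω0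
  have h1ω2 : 1 + ω ^ 2 ≠ 0 := by
    intro h; apply hω0; linear_combination hω - h
  have h1ω : 1 + ω ≠ 0 := by
    intro h; apply hω0
    have : ω = 1 := by linear_combination h - h2
    rw [this] at hω; have : (3 : F) = 0 := by linear_combination hω
    exfalso; exact one_ne_zero (by linear_combination this - h2 : (1 : F) = 0)
  have hωω2 : ω ^ 2 + ω ≠ 0 := by
    intro h; have : (1 : F) = 0 := by linear_combination hω - h
    exact one_ne_zero this
  cases ε with
  | true =>
      rw [cosetCharSum_true_eq hω hv]
      refine mul_ne_zero hP ?_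
      rw [cast_eq n₁, cast_eq n₂]
      -- n₁ odd, or z odd (then exactly one of n₁,n₂ is odd)
      simp only [if_true] at hpar
      by_cases ho1 : n₁ % 2 = 1
      · rw [if_pos ho1]
        by_cases ho2 : n₂ % 2 = 1
        · rw [if_pos ho2]; simpa using hωω2
        · rw [if_neg ho2]; simpa using hω2
      · have ho2 : n₂ % 2 = 1 := by
          rcases hpar with hodd | h
          · obtain ⟨r, hr⟩ := hodd; omega
          · exact absurd h ho1
        rw [if_neg ho1, if_pos ho2]; simpa using hω0
  | false =>
      rw [cosetCharSum_false_eq hω hv]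
      refine mul_ne_zero hP ?_
      rw [cast_eq n₁, cast_eq n₂]
      simp only [Bool.false_eq_true, if_false] at hpar
      by_cases ho1 : n₁ % 2 = 1
      · -- then z odd and n₂ even
        have ho2 : ¬ n₂ % 2 = 1 := by
          rcases hpar with hodd | h
          · obtain ⟨r, hr⟩ := hodd; omega
          · omega
        rw [if_pos ho1, if_neg ho2]; simpa using h1ω2
      · rw [if_neg ho1]
        by_cases ho2 : n₂ % 2 = 1
        · rw [if_pos ho2]; simpa using h1ω
        · rw [if_neg ho2]; simp

end Sign

/-! ### 5. (O) Orthogonality: testing `R ≡ κ` against `Q_v · 1_{H_ε}` -/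

/-- **(O)** If `R = Σ_g a_g Q_{w_g} ≡ κ` on `H_ε` then `Σ_g a_g Ŝ_ε(v + w_g) = κ·Ŝ_ε(v)` for all `v`.
[cite: BarringtonStraubingTherien1990, §6 (orthogonality of the P_w); coset form supplied here (qa-qnc0 ROUND-34 §11.4 (O))] -/
theorem sum_cosetCharSum_add_eq [CharP F 2] {ω : F} (hω : ω ^ 2 + ω + 1 = 0)
    (a : Fin m → F) (w : Fin m → Fin z → ZMod 3) {ε : Bool} {κ : F}
    (hconst : ∀ u ∈ parityCoset z ε, holoSum ω a w u = κ) (v : Fin z → ZMod 3) :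
    ∑ g, a g * cosetCharSum ω z ε (v + w g) = κ * cosetCharSum ω z ε v := by
  have h3 := omega_pow_three hω
  unfold cosetCharSum
  calc ∑ g, a g * ∑ u ∈ parityCoset z ε, cubeChar ω (v + w g) u
      = ∑ u ∈ parityCoset z ε, cubeChar ω v u * holoSum ω a w u := by
        unfold holoSum
        simp_rw [Finset.mul_sum]
        rw [Finset.sum_comm]
        refine sum_congr rfl fun u _ => sum_congr rfl fun g _ => ?_
        rw [← cubeChar_mul h3]; ring
    _ = ∑ u ∈ parityCoset z ε, cubeChar ω v u * κ := sum_congr rfl fun u hu => by rw [hconst u hu]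
    _ = κ * ∑ u ∈ parityCoset z ε, cubeChar ω v u := by rw [← Finset.sum_mul, mul_comm]

/-! ### 6. Counting sign patterns -/

section Counting

omit [Field F]

/-- A sub-cube with the coordinates in `S` pinned has `2^{z−|S|}` points. [folklore] -/
private theorem card_filter_forall_eq (S : Finset (Fin z)) (f : Fin z → Bool) :
    (univ.filter fun σ : Fin z → Bool => ∀ i ∈ S, σ i = f i).card = 2 ^ (z - S.card) := by
  classical
  -- bijection with functions on the complement
  let e : {σ : Fin z → Bool // ∀ i ∈ S, σ i = f i} ≃ ({i : Fin z // i ∉ S} → Bool) :=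
    { toFun := fun σ i => σ.1 i.1
      invFun := fun g => ⟨fun i => if h : i ∈ S then f i else g ⟨i, h⟩, fun i hi => by simp [hi]⟩
      left_inv := by
        rintro ⟨σ, hσ⟩; ext i
        by_cases hi : i ∈ S
        · simp [hi, hσ i hi]
        · simp [hi]
      right_inv := by intro g; funext ⟨i, hi⟩; simp [hi] }
  have h1 : (univ.filter fun σ : Fin z → Bool => ∀ i ∈ S, σ i = f i).card
      = Fintype.card {σ : Fin z → Bool // ∀ i ∈ S, σ i = f i} := by
    rw [Fintype.card_subtype]
  rw [h1, Fintype.card_congr e, Fintype.card_fun, Fintype.card_bool]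
  congr 1
  rw [Fintype.card_subtype_compl, Fintype.card_fin]
  congr 1
  simp [Fintype.card_subtype]

/-- **Counting**: the patterns `σ ∈ {0,1}^z` agreeing with a fixed pattern `τ` in AT MOST ONE point of `S`
number at most `(|S| + 1)·2^{z − |S|}`. [folklore] -/
private theorem card_filter_agree_le_one_le (S : Finset (Fin z)) (τ : Fin z → Bool) :
    (univ.filter fun σ : Fin z → Bool => (S.filter fun i => σ i = τ i).card ≤ 1).card
      ≤ (S.card + 1) * 2 ^ (z - S.card) := by
  classical
  -- the patterns: disagree everywhere on S, or agree exactly at j ∈ S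
  let pat : Option (Fin z) → Fin z → Bool := fun o i =>
    match o with
    | none => !τ i
    | some j => if i = j then τ i else !τ i
  have hsub : (univ.filter fun σ : Fin z → Bool => (S.filter fun i => σ i = τ i).card ≤ 1)
      ⊆ (insert none (S.image some)).biUnion
          (fun o => univ.filter fun σ : Fin z → Bool => ∀ i ∈ S, σ i = pat o i) := by
    intro σ hσ
    simp only [mem_filter, mem_univ, true_and] at hσ
    rw [mem_biUnion]
    rcases Nat.lt_or_ge ((S.filter fun i => σ i = τ i).card) 1 with h0 | h1
    · -- no agreement
      refine ⟨none, mem_insert_self _ _, ?_⟩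
      simp only [mem_filter, mem_univ, true_and]
      intro i hi
      have : i ∉ S.filter fun i => σ i = τ i := by
        have : (S.filter fun i => σ i = τ i) = ∅ := card_eq_zero.1 (by omega)
        rw [this]; exact notMem_empty i
      simp only [mem_filter, hi, true_and] at this
      show σ i = !τ i
      cases hs : σ i <;> cases ht : τ i <;> simp_all
    · -- exactly one agreement j
      have hc : (S.filter fun i => σ i = τ i).card = 1 := le_antisymm hσ h1
      obtain ⟨j, hj⟩ := card_eq_one.1 hc
      have hjS : j ∈ S := by
        have : j ∈ S.filter fun i => σ i = τ i := by rw [hj]; exact mem_singleton_self j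
        exact (mem_filter.1 this).1
      refine ⟨some j, mem_insert_of_mem (mem_image_of_mem _ hjS), ?_⟩
      simp only [mem_filter, mem_univ, true_and]
      intro i hi
      by_cases hij : i = j
      · subst hij
        have : i ∈ S.filter fun i => σ i = τ i := by rw [hj]; exact mem_singleton_self _
        simp only [pat, if_true]
        exact (mem_filter.1 this).2
      · have hnot : i ∉ S.filter fun i => σ i = τ i := by rw [hj]; simpa using hij
        simp only [mem_filter, hi, true_and] at hnot
        simp only [pat, if_neg hij]
        cases hs : σ i <;> cases ht : τ i <;> simp_all
  calc (univ.filter fun σ : Fin z → Bool => (S.filter fun i => σ i = τ i).card ≤ 1).card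
      ≤ ((insert none (S.image some)).biUnion
          (fun o => univ.filter fun σ : Fin z → Bool => ∀ i ∈ S, σ i = pat o i)).card := card_le_card hsub
    _ ≤ ∑ o ∈ insert none (S.image some),
          (univ.filter fun σ : Fin z → Bool => ∀ i ∈ S, σ i = pat o i).card := card_biUnion_le
    _ = ∑ _o ∈ insert none (S.image some), 2 ^ (z - S.card) :=
        sum_congr rfl fun o _ => card_filter_forall_eq S (pat o)
    _ = (S.card + 1) * 2 ^ (z - S.card) := by
        rw [sum_const, smul_eq_mul, card_insert_of_notMem (by simp),
          card_image_of_injective _ (Option.some_injective _)]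

/-- Monotonicity of the bound: `(s+1)2^{z−s} ≤ (K+1)2^{z−K}` for `K ≤ s ≤ z`. [folklore] -/
private theorem succ_mul_two_pow_sub_le {K s : ℕ} (hKs : K ≤ s) (hsz : s ≤ z) :
    (s + 1) * 2 ^ (z - s) ≤ (K + 1) * 2 ^ (z - K) := by
  obtain ⟨d, rfl⟩ := Nat.exists_eq_add_of_le hKs
  have hz : z - K = (z - (K + d)) + d := by omega
  rw [hz, pow_add]
  have hd : K + d + 1 ≤ (K + 1) * 2 ^ d := by
    have : d + 1 ≤ 2 ^ d := by
      induction d with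
      | zero => norm_num
      | succ n ih => rw [pow_succ]; omega
    nlinarith
  calc (K + d + 1) * 2 ^ (z - (K + d)) ≤ (K + 1) * 2 ^ d * 2 ^ (z - (K + d)) :=
        Nat.mul_le_mul_right _ hd
    _ = (K + 1) * (2 ^ (z - (K + d)) * 2 ^ d) := by ring

/-- Half of the cube has an even number of `false` coordinates (for `z ≥ 1`). [folklore] -/
private theorem two_pow_le_two_mul_card_filter_parity (hz : 0 < z) (r : ℕ) :
    2 ^ z ≤ 2 * (univ.filter fun σ : Fin z → Bool =>
      (univ.filter fun i => σ i = false).card % 2 = r).card ∨ r ≥ 2 := by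
  classical
  by_cases hr : r ≥ 2
  · exact Or.inr hr
  left
  -- the toggle at coordinate 0 maps the complement into the set
  let i₀ : Fin z := ⟨0, hz⟩
  set A := univ.filter fun σ : Fin z → Bool => (univ.filter fun i => σ i = false).card % 2 = r with hA
  have hflip : ∀ σ : Fin z → Bool,
      (univ.filter fun i => (Function.update σ i₀ (!σ i₀)) i = false).card % 2
        ≠ (univ.filter fun i => σ i = false).card % 2 := by
    intro σ
    by_cases h0 : σ i₀ = false
    · have hset : (univ.filter fun i => (Function.update σ i₀ (!σ i₀)) i = false)
          = (univ.filter fun i => σ i = false).erase i₀ := by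
        ext k; by_cases hk : k = i₀
        · subst hk; simp [h0]
        · simp [hk]
      have hmem : i₀ ∈ univ.filter fun i => σ i = false := by simp [h0]
      rw [hset, card_erase_of_mem hmem]
      have := card_pos.2 ⟨i₀, hmem⟩
      omega
    · have h0' : σ i₀ = true := by simpa using h0
      have hset : (univ.filter fun i => (Function.update σ i₀ (!σ i₀)) i = false)
          = insert i₀ (univ.filter fun i => σ i = false) := by
        ext k; by_cases hk : k = i₀
        · subst hk; simp [h0']
        · simp [hk]
      have hnot : i₀ ∉ univ.filter fun i => σ i = false := by simp [h0']
      rw [hset, card_insert_of_notMem hnot]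
      omega
  -- complement maps injectively into A
  have hmap : ∀ σ ∈ Aᶜ, Function.update σ i₀ (!σ i₀) ∈ A := by
    intro σ hσ
    rw [mem_compl, hA, mem_filter, not_and] at hσ
    have h1 := hσ (mem_univ σ)
    rw [hA, mem_filter]
    refine ⟨mem_univ _, ?_⟩
    have := hflip σ
    have hr2 : r < 2 := by omega
    omega
  have hinj : Set.InjOn (fun σ : Fin z → Bool => Function.update σ i₀ (!σ i₀)) (Aᶜ : Finset _) := by
    intro σ _ σ' _ h
    have key : ∀ τ : Fin z → Bool, Function.update (Function.update τ i₀ (!τ i₀)) i₀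
        (!(Function.update τ i₀ (!τ i₀)) i₀) = τ := by
      intro τ; funext k; by_cases hk : k = i₀
      · subst hk; simp
      · simp [Function.update_of_ne hk]
    have := congrArg (fun τ : Fin z → Bool => Function.update τ i₀ (!τ i₀)) h
    simp only [key] at this
    exact this
  have hle : (Aᶜ).card ≤ A.card := card_le_card_of_injOn _ hmap hinj
  have htot : A.card + (Aᶜ).card = 2 ^ z := by
    rw [Finset.card_add_card_compl, Fintype.card_fun, Fintype.card_bool, Fintype.card_fin]
  omega

end Counting

/-! ### 7. `SparseKappa` -/

/-- The sign vector of a pattern: `v_σ(i) = 2` if `σ_i`, else `1` (a point of `{1,2}^z`).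
[cite: BarringtonStraubingTherien1990, §6 (the vectors w ∈ (F*)ⁿ); bookkeeping supplied here] -/
def signVec (σ : Fin z → Bool) : Fin z → ZMod 3 := fun i => if σ i then 2 else 1

omit [Field F] in
/-- Sign vectors have no zero coordinate. [folklore] -/
private theorem signVec_ne_zero (σ : Fin z → Bool) (i : Fin z) : signVec σ i ≠ 0 := by
  unfold signVec; split_ifs <;> decide

omit [Field F] in
/-- `#{v_σ = 1} = #{σ = false}`. [folklore] -/
private theorem card_signVec_eq_one (σ : Fin z → Bool) :
    (univ.filter fun i => signVec σ i = 1).card = (univ.filter fun i => σ i = false).card := by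
  congr 1; ext i; simp only [mem_filter, mem_univ, true_and, signVec]
  cases σ i <;> simp
  all_goals decide

omit [Field F] in
/-- The zeros of `v_σ + w` are the coins of `w` where `σ` agrees with the pattern `[w_i = 1]`. [folklore] -/
private theorem signVec_add_eq_zero_iff (σ : Fin z → Bool) (w : Fin z → ZMod 3) (i : Fin z) :
    (signVec σ + w) i = 0 ↔ w i ≠ 0 ∧ σ i = decide (w i = 1) := by
  simp only [Pi.add_apply, signVec]
  have : (w i).val = 0 ∨ (w i).val = 1 ∨ (w i).val = 2 := by have := (w i).val_lt; omega
  rcases this with h | h | h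
  · have hw : w i = 0 := (ZMod.val_eq_zero _).1 h
    rw [hw]; cases σ i <;> simp
    all_goals decide
  · have hw : w i = 1 := ZMod.val_injective 3 (by rw [h]; rfl)
    rw [hw]; cases σ i <;> simp
    all_goals decide
  · have hw : w i = 2 := ZMod.val_injective 3 (by rw [h]; rfl)
    rw [hw]; cases σ i <;> simp
    all_goals decide

/-- **`SparseKappa` (`P-38e`, typed `AffBells35.SparseKappa` verbatim).**  In characteristic `2` with
`ω² + ω + 1 = 0`: a holomorphic sum `Σ_g a_g Q_{w_g}` of `m` characters, each term with coin support
`≥ K`, which is constant `= κ` on a parity coset of `{0,1}^z` (`z ≥ 1`), has `κ = 0` as soon as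
`2m(K+1) < 2^K`.  Proof: test against `Q_v·1_{H_ε}` for a sign vector `v` chosen by counting so that
`Ŝ_ε(v) ≠ 0` ((N)) while every `v + w_g` has two zero coordinates ((V)).
[cite: BarringtonStraubingTherien1990, §6 (Proposition: uncertainty for the P_w); sparse-coset rigidity supplied here (qa-qnc0 ROUND-34 §11.4)] -/
theorem sparseKappa (F : Type*) [Field F] [CharP F 2] (ω : F) (hω : ω ^ 2 + ω + 1 = 0)
    (z m K : ℕ) (a : Fin m → F) (w : Fin m → Fin z → ZMod 3) (ε : Bool) (κ : F)
    (hz : 0 < z) (hmK : 2 * m * (K + 1) < 2 ^ K) (hsupp : ∀ g, a g ≠ 0 → K ≤ (wsupp (w g)).card)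
    (hconst : ∀ u ∈ parityCoset z ε, holoSum ω a w u = κ) : κ = 0 := by
  classical
  -- target parity class of σ (so that (N) applies): r = [ε] if z even, anything if z odd
  set r : ℕ := if ε then 1 else 0 with hr
  set Good := univ.filter fun σ : Fin z → Bool => (univ.filter fun i => σ i = false).card % 2 = r
  set Bad : Fin m → Finset (Fin z → Bool) := fun g =>
    univ.filter fun σ => ((wsupp (w g)).filter fun i => σ i = decide (w g i = 1)).card ≤ 1
  -- counting: Good is at least half the cube, the bad sets are small
  have hGood : 2 ^ z ≤ 2 * Good.card := by
    rcases two_pow_le_two_mul_card_filter_parity hz r with h | h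
    · exact h
    · exfalso; rw [hr] at h; split_ifs at h <;> omega
  have hBad : ∀ g, a g ≠ 0 → (Bad g).card * 2 ^ K ≤ (K + 1) * 2 ^ z := by
    intro g hg
    have hK := hsupp g hg
    have hsz : (wsupp (w g)).card ≤ z := by
      calc (wsupp (w g)).card ≤ (univ : Finset (Fin z)).card := card_le_card (subset_univ _)
        _ = z := by rw [card_univ, Fintype.card_fin]
    have h1 := card_filter_agree_le_one_le (wsupp (w g)) (fun i => decide (w g i = 1))
    have h2 := succ_mul_two_pow_sub_le (z := z) hK hsz
    have hKz : K ≤ z := hK.trans hsz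
    calc (Bad g).card * 2 ^ K ≤ (K + 1) * 2 ^ (z - K) * 2 ^ K := Nat.mul_le_mul_right _ (h1.trans h2)
      _ = (K + 1) * 2 ^ z := by rw [mul_assoc, ← pow_add, Nat.sub_add_cancel hKz]
  -- a good pattern outside every bad set exists
  have hex : ∃ σ ∈ Good, ∀ g, a g ≠ 0 → σ ∉ Bad g := by
    by_contra hno
    push Not at hno
    -- Good ⊆ ⋃ Bad
    have hsub : Good ⊆ (univ.filter fun g => a g ≠ 0).biUnion Bad := by
      intro σ hσ
      obtain ⟨g, hg, hσg⟩ := hno σ hσ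
      exact mem_biUnion.2 ⟨g, by simp [hg], hσg⟩
    have hcard : Good.card * 2 ^ K ≤ m * ((K + 1) * 2 ^ z) := by
      calc Good.card * 2 ^ K ≤ ((univ.filter fun g => a g ≠ 0).biUnion Bad).card * 2 ^ K :=
            Nat.mul_le_mul_right _ (card_le_card hsub)
        _ ≤ (∑ g ∈ univ.filter (fun g => a g ≠ 0), (Bad g).card) * 2 ^ K :=
            Nat.mul_le_mul_right _ card_biUnion_le
        _ = ∑ g ∈ univ.filter (fun g => a g ≠ 0), (Bad g).card * 2 ^ K := by rw [Finset.sum_mul]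
        _ ≤ ∑ g ∈ univ.filter (fun g => a g ≠ 0), (K + 1) * 2 ^ z :=
            sum_le_sum fun g hg => hBad g (mem_filter.1 hg).2
        _ ≤ ∑ _g : Fin m, (K + 1) * 2 ^ z := sum_le_sum_of_subset_of_nonneg (filter_subset _ _)
            (fun _ _ _ => Nat.zero_le _)
        _ = m * ((K + 1) * 2 ^ z) := by rw [sum_const, card_univ, Fintype.card_fin, smul_eq_mul]
    -- 2^z 2^K ≤ 2·Good·2^K ≤ 2m(K+1)2^z < 2^K 2^z
    have : 2 ^ z * 2 ^ K < 2 ^ K * 2 ^ z := by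
      calc 2 ^ z * 2 ^ K ≤ 2 * Good.card * 2 ^ K := Nat.mul_le_mul_right _ hGood
        _ = 2 * (Good.card * 2 ^ K) := by ring
        _ ≤ 2 * (m * ((K + 1) * 2 ^ z)) := Nat.mul_le_mul_left _ hcard
        _ = 2 * m * (K + 1) * 2 ^ z := by ring
        _ < 2 ^ K * 2 ^ z := Nat.mul_lt_mul_of_pos_right hmK (by positivity)
    rw [mul_comm] at this
    exact lt_irrefl _ this
  obtain ⟨σ, hσG, hσB⟩ := hex
  set v := signVec σ with hv
  -- (N): Ŝ_ε(v) ≠ 0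
  have hN : cosetCharSum ω z ε v ≠ 0 := by
    refine cosetCharSum_ne_zero hω ε v hz (signVec_ne_zero σ) ?_
    rcases Nat.even_or_odd z with he | ho
    · right
      rw [card_signVec_eq_one]
      have := (mem_filter.1 hσG).2
      rw [this, hr]
    · exact Or.inl ho
  -- (V): every live term dies
  have hV : ∀ g, a g * cosetCharSum ω z ε (v + w g) = 0 := by
    intro g
    by_cases hg : a g = 0
    · rw [hg, zero_mul]
    · have hnot := hσB g hg
      simp only [Bad, mem_filter, mem_univ, true_and, not_le] at hnot
      -- two distinct coins where σ agrees ⇒ two zeros of v + w_g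
      obtain ⟨i, hi, j, hj, hij⟩ := Finset.one_lt_card.1 hnot
      rw [mem_filter] at hi hj
      have hzi : (v + w g) i = 0 :=
        (signVec_add_eq_zero_iff σ (w g) i).2 ⟨(mem_filter.1 hi.1).2, hi.2⟩
      have hzj : (v + w g) j = 0 :=
        (signVec_add_eq_zero_iff σ (w g) j).2 ⟨(mem_filter.1 hj.1).2, hj.2⟩
      rw [cosetCharSum_eq_zero_of_two_zeros ω ε (v + w g) hij hzi hzj, mul_zero]
  -- (O): 0 = κ Ŝ_ε(v)
  have hO := sum_cosetCharSum_add_eq hω a w hconst v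
  rw [sum_eq_zero fun g _ => hV g] at hO
  exact (mul_eq_zero.1 hO.symm).resolve_right hN

/-! ### 8. `HoloIsolation` (P-38b′): partners are Hamming-close -/

section Isolation

omit [Field F]

/-- Parity classes of the number of `false` coordinates INSIDE a set `E ∋ k₀` each contain at least half
of the patterns. [folklore] -/
private theorem two_pow_le_two_mul_card_parityOn (E : Finset (Fin z)) {k₀ : Fin z} (hk₀ : k₀ ∈ E)
    (r : ℕ) (hr : r < 2) :
    2 ^ z ≤ 2 * (univ.filter fun σ : Fin z → Bool => (E.filter fun i => σ i = false).card % 2 = r).card := by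
  classical
  set A := univ.filter fun σ : Fin z → Bool => (E.filter fun i => σ i = false).card % 2 = r with hA
  have hflip : ∀ σ : Fin z → Bool,
      (E.filter fun i => (Function.update σ k₀ (!σ k₀)) i = false).card % 2
        ≠ (E.filter fun i => σ i = false).card % 2 := by
    intro σ
    by_cases h0 : σ k₀ = false
    · have hset : (E.filter fun i => (Function.update σ k₀ (!σ k₀)) i = false)
          = (E.filter fun i => σ i = false).erase k₀ := by
        ext k; by_cases hk : k = k₀
        · subst hk; simp [h0]
        · simp [hk]
      have hmem : k₀ ∈ E.filter fun i => σ i = false := by simp [h0, hk₀]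
      rw [hset, card_erase_of_mem hmem]
      have := card_pos.2 ⟨k₀, hmem⟩
      omega
    · have h0' : σ k₀ = true := by simpa using h0
      have hset : (E.filter fun i => (Function.update σ k₀ (!σ k₀)) i = false)
          = insert k₀ (E.filter fun i => σ i = false) := by
        ext k; by_cases hk : k = k₀
        · subst hk; simp [h0', hk₀]
        · simp [hk]
      have hnot : k₀ ∉ E.filter fun i => σ i = false := by simp [h0']
      rw [hset, card_insert_of_notMem hnot]
      omega
  have hmap : ∀ σ ∈ Aᶜ, Function.update σ k₀ (!σ k₀) ∈ A := by
    intro σ hσ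
    rw [mem_compl, hA, mem_filter, not_and] at hσ
    have h1 := hσ (mem_univ σ)
    rw [hA, mem_filter]
    refine ⟨mem_univ _, ?_⟩
    have := hflip σ
    omega
  have hinj : Set.InjOn (fun σ : Fin z → Bool => Function.update σ k₀ (!σ k₀)) (Aᶜ : Finset _) := by
    intro σ _ σ' _ h
    have key : ∀ τ : Fin z → Bool, Function.update (Function.update τ k₀ (!τ k₀)) k₀
        (!(Function.update τ k₀ (!τ k₀)) k₀) = τ := by
      intro τ; funext k; by_cases hk : k = k₀
      · subst hk; simp
      · simp [Function.update_of_ne hk]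
    have := congrArg (fun τ : Fin z → Bool => Function.update τ k₀ (!τ k₀)) h
    simp only [key] at this
    exact this
  have hle : (Aᶜ).card ≤ A.card := card_le_card_of_injOn _ hmap hinj
  have htot : A.card + (Aᶜ).card = 2 ^ z := by
    rw [Finset.card_add_card_compl, Fintype.card_fun, Fintype.card_bool, Fintype.card_fin]
  omega

/-- `8D < 2^D` forces `D = 0` or `D ≥ 6`. [folklore] -/
private theorem six_le_of_eight_mul_lt {D : ℕ} (h : 8 * D < 2 ^ D) (h0 : 0 < D) : 6 ≤ D := by
  by_contra hlt
  push Not at hlt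
  interval_cases D <;> norm_num at h

end Isolation

/-- **`HoloIsolation` (`P-38b′`; typed `AffBells35.HoloIsolation` verbatim, corrected typing with the
binder `3 ≤ D` — at `D = 0` the conclusion `hdist < 0` is impossible while `Q_0 ≡ 1` satisfies the other
hypotheses; given `8mD < 2^D` and `m ≥ 1`, any `D ≥ 1` already forces `D ≥ 6`).**  In a holomorphic sum `R = Σ_g a_g Q_{w_g}` constant on a parity coset of `{0,1}^z`,
every exponent vector `w_b` with non-zero merged coefficient and `|supp w_b| ≥ D` has ANOTHER exponent
vector with non-zero merged coefficient at Hamming distance `< D`, as soon as `8mD < 2^D`.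
Proof: test vectors `v = s − w_b` with `v_{i₀} = v_{j₀} = 0` at two coins of `w_b` (so `Ŝ_ε(v) = 0`
by (V) and the right side of (O) vanishes whatever `κ` is) and `s` a SIGN vector (so `Ŝ_ε(v + w_b) =
Ŝ_ε(s) ≠ 0` by (N) for half of the patterns); a class `w'` at distance `d ≥ D` is killed by (V) unless
`s` agrees with the pattern `w_b − w'` in `≤ 1` of the `≥ d − 2` free differing coordinates
(`≤ (d−1)·2^{z−d+2}` patterns); union bound; the surviving relation is `A(w_b)Ŝ_ε(s) = ` (near classes).
[cite: BarringtonStraubingTherien1990, §6 (Proposition: uncertainty); isolation form supplied here (qa-qnc0 ROUND-34 §11.4)] -/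
theorem holoIsolation (F : Type*) [Field F] [CharP F 2] (ω : F) (hω : ω ^ 2 + ω + 1 = 0)
    (z m D : ℕ) (a : Fin m → F) (w : Fin m → Fin z → ZMod 3) (ε : Bool) (b : Fin m)
    (hmD : 8 * m * D < 2 ^ D) (hD3 : 3 ≤ D) (hDb : D ≤ (wsupp (w b)).card) (hA : mergedCoeff a w b ≠ 0)
    (hconst : ∃ κ : F, ∀ u ∈ parityCoset z ε, holoSum ω a w u = κ) :
    ∃ g : Fin m, w g ≠ w b ∧ mergedCoeff a w g ≠ 0 ∧ hdist (w g) (w b) < D := by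
  classical
  obtain ⟨κ, hκ⟩ := hconst
  -- D ≥ 6 (m ≥ 1 since b exists)
  have hm : 1 ≤ m := Nat.one_le_iff_ne_zero.2 fun h => by subst h; exact b.elim0
  have hD6 : 6 ≤ D := by
    refine six_le_of_eight_mul_lt (lt_of_le_of_lt ?_ hmD) (by omega)
    calc 8 * D = 8 * 1 * D := by ring
      _ ≤ 8 * m * D := Nat.mul_le_mul_right _ (Nat.mul_le_mul_left _ hm)
  -- two coins i₀ ≠ j₀ of w_b
  obtain ⟨i₀, hi₀, j₀, hj₀, hij⟩ : ∃ i₀ ∈ wsupp (w b), ∃ j₀ ∈ wsupp (w b), i₀ ≠ j₀ :=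
    Finset.one_lt_card.1 (by omega)
  have hbi : w b i₀ ≠ 0 := (mem_filter.1 hi₀).2
  have hbj : w b j₀ ≠ 0 := (mem_filter.1 hj₀).2
  -- test vectors: s_σ sign vector with s = w_b at i₀, j₀; v_σ = s_σ − w_b
  let pin : Finset (Fin z) := {i₀, j₀}
  let sv : (Fin z → Bool) → Fin z → ZMod 3 := fun σ i => if i ∈ pin then w b i else signVec σ i
  let tv : (Fin z → Bool) → Fin z → ZMod 3 := fun σ => sv σ - w b
  have hsv_ne : ∀ σ i, sv σ i ≠ 0 := by
    intro σ i
    simp only [sv]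
    split_ifs with h
    · simp only [pin, mem_insert, mem_singleton] at h
      rcases h with rfl | rfl
      · exact hbi
      · exact hbj
    · exact signVec_ne_zero σ i
  have htv_pin : ∀ σ, tv σ i₀ = 0 ∧ tv σ j₀ = 0 := by
    intro σ; simp [tv, sv, pin]
  -- the counted coordinates for the parity class of s_σ: E = complement of the pins
  let E : Finset (Fin z) := univ.filter fun i => i ∉ pin
  -- a third coordinate k₀ ∈ E (z ≥ |wsupp w_b| ≥ 6)
  obtain ⟨k₀, hk₀⟩ : ∃ k₀, k₀ ∈ E := by
    have hz3 : 3 ≤ (univ : Finset (Fin z)).card :=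
      le_trans (by omega) (card_le_card (subset_univ (wsupp (w b))))
    have hcardE : (univ : Finset (Fin z)).card ≤ E.card + pin.card := by
      calc (univ : Finset (Fin z)).card ≤ (E ∪ pin).card := card_le_card fun i _ => by
            by_cases h : i ∈ pin
            · exact mem_union_right _ h
            · exact mem_union_left _ (by simp [E, h])
        _ ≤ E.card + pin.card := card_union_le _ _
    have hpin : pin.card ≤ 2 := by
      simp only [pin]; exact (card_insert_le _ _).trans (by simp)
    have : 0 < E.card := by omega
    exact card_pos.1 this
  -- n₁(s_σ) = #{i ∈ E : σ i = false} + c_b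
  let cb : ℕ := (pin.filter fun i => w b i = 1).card
  have hn1 : ∀ σ, (univ.filter fun i => sv σ i = 1).card = (E.filter fun i => σ i = false).card + cb := by
    intro σ
    have hsplit : (univ.filter fun i => sv σ i = 1)
        = (E.filter fun i => σ i = false) ∪ (pin.filter fun i => w b i = 1) := by
      ext i
      simp only [mem_filter, mem_univ, true_and, mem_union, E, sv]
      by_cases hp : i ∈ pin
      · simp only [hp, ↓reduceIte, not_true_eq_false, false_and, false_or, true_and]
      · simp only [hp, ↓reduceIte, not_false_eq_true, true_and, false_and, or_false, signVec]
        cases σ i <;> simp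
        all_goals decide
    rw [hsplit, card_union_of_disjoint]
    rw [Finset.disjoint_left]
    intro i hi hi'
    exact (mem_filter.1 (mem_filter.1 hi).1).2 (mem_filter.1 hi').1
  -- Good patterns: (N) applies to s_σ
  set r : ℕ := (if ε then 1 else 0) + cb % 2 with hr
  set r' : ℕ := r % 2 with hr'
  let Good := univ.filter fun σ : Fin z → Bool => (E.filter fun i => σ i = false).card % 2 = r'
  have hGood : 2 ^ z ≤ 2 * Good.card :=
    two_pow_le_two_mul_card_parityOn E hk₀ r' (Nat.mod_lt _ (by norm_num))
  have hGoodN : ∀ σ ∈ Good, cosetCharSum ω z ε (sv σ) ≠ 0 := by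
    intro σ hσ
    have hz : 0 < z := Fin.pos i₀
    refine cosetCharSum_ne_zero hω ε (sv σ) hz (hsv_ne σ) ?_
    rcases Nat.even_or_odd z with _ | ho
    · right
      rw [hn1 σ]
      have hE := (mem_filter.1 hσ).2
      rw [Nat.add_mod, hE, hr', hr]
      cases ε <;> simp <;> omega
    · exact Or.inl ho
  -- Bad patterns for a far class
  let Tfree : Fin m → Finset (Fin z) := fun g => E.filter fun i => w g i ≠ w b i
  let τ : Fin m → Fin z → Bool := fun g i => decide (w b i - w g i = 2)
  let Bad : Fin m → Finset (Fin z → Bool) := fun g =>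
    univ.filter fun σ => ((Tfree g).filter fun i => σ i = τ g i).card ≤ 1
  have hzero_iff : ∀ g σ i, i ∈ Tfree g → ((tv σ + w g) i = 0 ↔ σ i = τ g i) := by
    intro g σ i hi
    have hiE : i ∉ pin := (mem_filter.1 (mem_filter.1 hi).1).2
    have hne : w g i ≠ w b i := (mem_filter.1 hi).2
    simp only [tv, sv, Pi.add_apply, Pi.sub_apply, hiE, ↓reduceIte, τ, signVec]
    -- s − w_b + w_g = 0 ↔ s = w_b − w_g, with s ∈ {1,2} and w_b − w_g ≠ 0
    have hd : w b i - w g i ≠ 0 := sub_ne_zero.2 (Ne.symm hne)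
    have : (w b i - w g i).val = 1 ∨ (w b i - w g i).val = 2 := by
      have hl := (w b i - w g i).val_lt
      have h0 : (w b i - w g i).val ≠ 0 := fun h0 => hd ((ZMod.val_eq_zero _).1 h0)
      omega
    rcases this with h | h
    · have hδ : w b i - w g i = 1 := ZMod.val_injective 3 (by rw [h]; rfl)
      have : (if σ i = true then (2 : ZMod 3) else 1) - w b i + w g i = (if σ i = true then 2 else 1) - (w b i - w g i) := by ring
      rw [this, hδ]; cases σ i <;> simp
      all_goals decide
    · have hδ : w b i - w g i = 2 := ZMod.val_injective 3 (by rw [h]; rfl)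
      have : (if σ i = true then (2 : ZMod 3) else 1) - w b i + w g i = (if σ i = true then 2 else 1) - (w b i - w g i) := by ring
      rw [this, hδ]; cases σ i <;> simp
      all_goals decide
  -- far classes have many free differing coordinates
  have hTfree : ∀ g, D ≤ hdist (w g) (w b) → D - 2 ≤ (Tfree g).card := by
    intro g hd
    have hsub : (univ.filter fun i => w g i ≠ w b i) ⊆ Tfree g ∪ pin := by
      intro i hi
      by_cases hp : i ∈ pin
      · exact mem_union_right _ hp
      · exact mem_union_left _ (mem_filter.2 ⟨mem_filter.2 ⟨mem_univ _, hp⟩, (mem_filter.1 hi).2⟩)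
    have hpin : pin.card ≤ 2 := by
      simp only [pin]; exact (card_insert_le _ _).trans (by simp)
    have := (card_le_card hsub).trans (card_union_le _ _)
    unfold hdist at hd
    omega
  have hBad : ∀ g, D ≤ hdist (w g) (w b) → (Bad g).card * 2 ^ D ≤ (D - 1) * 2 ^ 2 * 2 ^ z := by
    intro g hd
    have hK := hTfree g hd
    have hsz : (Tfree g).card ≤ z := by
      calc (Tfree g).card ≤ (univ : Finset (Fin z)).card := card_le_card (subset_univ _)
        _ = z := by rw [card_univ, Fintype.card_fin]
    have h1 := card_filter_agree_le_one_le (Tfree g) (τ g)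
    have h2 := succ_mul_two_pow_sub_le (z := z) hK hsz
    have hKz : D - 2 ≤ z := hK.trans hsz
    have hD2 : D - 2 + 1 = D - 1 := by omega
    calc (Bad g).card * 2 ^ D ≤ (D - 2 + 1) * 2 ^ (z - (D - 2)) * 2 ^ D := Nat.mul_le_mul_right _ (h1.trans h2)
      _ = (D - 1) * (2 ^ (z - (D - 2)) * 2 ^ (D - 2)) * 2 ^ 2 := by
          rw [hD2, show (2 : ℕ) ^ D = 2 ^ (D - 2) * 2 ^ 2 by rw [← pow_add]; congr 1; omega]; ring
      _ = (D - 1) * 2 ^ z * 2 ^ 2 := by rw [← pow_add, Nat.sub_add_cancel hKz]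
      _ = (D - 1) * 2 ^ 2 * 2 ^ z := by ring
  -- a good pattern outside every far bad set
  have hex : ∃ σ ∈ Good, ∀ g, D ≤ hdist (w g) (w b) → σ ∉ Bad g := by
    by_contra hno
    push Not at hno
    have hsub : Good ⊆ (univ.filter fun g => D ≤ hdist (w g) (w b)).biUnion Bad := by
      intro σ hσ
      obtain ⟨g, hg, hσg⟩ := hno σ hσ
      exact mem_biUnion.2 ⟨g, by simp [hg], hσg⟩
    have hcard : Good.card * 2 ^ D ≤ m * ((D - 1) * 2 ^ 2 * 2 ^ z) := by
      calc Good.card * 2 ^ D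
          ≤ ((univ.filter fun g => D ≤ hdist (w g) (w b)).biUnion Bad).card * 2 ^ D :=
            Nat.mul_le_mul_right _ (card_le_card hsub)
        _ ≤ (∑ g ∈ univ.filter (fun g => D ≤ hdist (w g) (w b)), (Bad g).card) * 2 ^ D :=
            Nat.mul_le_mul_right _ card_biUnion_le
        _ = ∑ g ∈ univ.filter (fun g => D ≤ hdist (w g) (w b)), (Bad g).card * 2 ^ D := by
            rw [Finset.sum_mul]
        _ ≤ ∑ g ∈ univ.filter (fun g => D ≤ hdist (w g) (w b)), (D - 1) * 2 ^ 2 * 2 ^ z :=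
            sum_le_sum fun g hg => hBad g (mem_filter.1 hg).2
        _ ≤ ∑ _g : Fin m, (D - 1) * 2 ^ 2 * 2 ^ z :=
            sum_le_sum_of_subset_of_nonneg (filter_subset _ _) (fun _ _ _ => Nat.zero_le _)
        _ = m * ((D - 1) * 2 ^ 2 * 2 ^ z) := by rw [sum_const, card_univ, Fintype.card_fin, smul_eq_mul]
    have hDm1 : 8 * m * (D - 1) < 2 ^ D := lt_of_le_of_lt (Nat.mul_le_mul_left _ (Nat.sub_le _ _)) hmD
    have : 2 ^ z * 2 ^ D < 2 ^ D * 2 ^ z := by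
      calc 2 ^ z * 2 ^ D ≤ 2 * Good.card * 2 ^ D := Nat.mul_le_mul_right _ hGood
        _ = 2 * (Good.card * 2 ^ D) := by ring
        _ ≤ 2 * (m * ((D - 1) * 2 ^ 2 * 2 ^ z)) := Nat.mul_le_mul_left _ hcard
        _ = 8 * m * (D - 1) * 2 ^ z := by ring
        _ < 2 ^ D * 2 ^ z := Nat.mul_lt_mul_of_pos_right hDm1 (by positivity)
    rw [mul_comm] at this
    exact lt_irrefl _ this
  obtain ⟨σ, hσG, hσB⟩ := hex
  -- the relation: (O) with v = tv σ, and Ŝ_ε(v) = 0 by (V)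
  have hO := sum_cosetCharSum_add_eq hω a w hκ (tv σ)
  rw [cosetCharSum_eq_zero_of_two_zeros ω ε (tv σ) hij (htv_pin σ).1 (htv_pin σ).2, mul_zero] at hO
  -- far classes die
  have hfar : ∀ g, D ≤ hdist (w g) (w b) → cosetCharSum ω z ε (tv σ + w g) = 0 := by
    intro g hd
    have hnot := hσB g hd
    simp only [Bad, mem_filter, mem_univ, true_and, not_le] at hnot
    obtain ⟨i, hi, j, hj, hij'⟩ := Finset.one_lt_card.1 hnot
    rw [mem_filter] at hi hj
    exact cosetCharSum_eq_zero_of_two_zeros ω ε _ hij' ((hzero_iff g σ i hi.1).2 hi.2)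
      ((hzero_iff g σ j hj.1).2 hj.2)
  -- the class of b survives: tv σ + w b = sv σ
  have hself : cosetCharSum ω z ε (tv σ + w b) ≠ 0 := by
    have : tv σ + w b = sv σ := by funext i; simp [tv]
    rw [this]; exact hGoodN σ hσG
  by_contra hno
  push Not at hno
  rw [sum_eq_mergedCoeff_mul a w b (fun y => cosetCharSum ω z ε (tv σ + y)) ?_] at hO
  · exact mul_ne_zero hA hself hO
  · intro g hg
    by_cases hAg : mergedCoeff a w g = 0
    · exact Or.inl hAg
    · right
      exact hfar g (hno g hg hAg)

/-! ### 9. The Silence Lemma (P-38j): LOCAL ⇒ SILENT -/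

/-- **Silence Lemma (`P-38j`; typed `AffBells35.SilenceOfLocal` verbatim).**  Split the coordinates into
an outside block `Fin z` (far forms `w_g`, all `K`-wide, `2m(K+1) < 2^K`) and a local block `Fin z₂`
(forms `ℓ_g`).  If the aggregate `(t,u) ↦ Σ_g a_g Q_{ℓ_g}(t) Q_{w_g}(u)`, restricted for each local
assignment `t` to the parity coset `H_{ε ⊕ |t|}` of the outside block, depends only on `t`, then it
vanishes identically.  Proof: for fixed `t` this is `sparseKappa` with coefficients `a_g Q_{ℓ_g}(t)`.
[cite: BarringtonStraubingTherien1990, §6 (uncertainty principle); corollary supplied here (qa-qnc0 ROUND-34 §12.3)] -/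
theorem silenceOfLocal (F : Type*) [Field F] [CharP F 2] (ω : F) (hω : ω ^ 2 + ω + 1 = 0)
    (z z₂ m K : ℕ) (a : Fin m → F) (w : Fin m → Fin z → ZMod 3) (ℓ : Fin m → Fin z₂ → ZMod 3)
    (ε : Bool) (A : (Fin z₂ → Bool) → F) (hz : 0 < z) (hmK : 2 * m * (K + 1) < 2 ^ K)
    (hsupp : ∀ g, a g ≠ 0 → K ≤ (wsupp (w g)).card)
    (hloc : ∀ t : Fin z₂ → Bool, ∀ u ∈ parityCoset z
        (xor ε (decide (Odd (univ.filter fun i => t i = true).card))),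
      ∑ g, a g * cubeChar ω (ℓ g) t * cubeChar ω (w g) u = A t)
    (t : Fin z₂ → Bool) : A t = 0 := by
  refine sparseKappa F ω hω z m K (fun g => a g * cubeChar ω (ℓ g) t) w
    (xor ε (decide (Odd (univ.filter fun i => t i = true).card))) (A t) hz hmK
    (fun g hg => hsupp g fun h => hg (by rw [h, zero_mul])) fun u hu => ?_
  rw [← hloc t u hu]
  unfold holoSum
  exact sum_congr rfl fun g _ => by ring

/-! ### 10. Scale isolation (P-38k): partners stick out of the support by `< D` -/

/-- The part of an exponent vector `w'` OUTSIDE the support of `wb` (typed `AffBells35.wout` verbatim).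
[cite: BarringtonStraubingTherien1990, §6; notation supplied here (qa-qnc0 ROUND-34 §12.5)] -/
def wout (wb w' : Fin z → ZMod 3) : Fin z → ZMod 3 := fun i => if wb i = 0 then w' i else 0

/-- **Scale isolation (`P-38k`; typed `AffBells35.ScaleIsolation` verbatim).**  In a holomorphic sum
constant on a parity coset with `2m(D+1) < 2^D`, an exponent vector `w_b` with `|supp w_b| ≥ 3` and
non-zero merged coefficient has ANOTHER exponent vector with non-zero merged coefficient that sticks
out of `supp w_b` by fewer than `D` coordinates (no relation between `D` and `|supp w_b|`).  Proof: the
test vectors of `holoIsolation` (two zeros at coins of `w_b`, a sign vector `s = v + w_b`, parity class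
of `s` adjusted on the non-pinned coordinates); a class sticking out by `n ≥ D` coordinates is killed by
(V) unless `s` matches `−w'` on `≤ 1` of those `n` outside coordinates (`≤ (n+1)2^{z−n}` patterns);
union bound `m(D+1)2^{z−D} < 2^{z−1}`.
[cite: BarringtonStraubingTherien1990, §6 (Proposition: uncertainty); isolation form supplied here (qa-qnc0 ROUND-34 §12.5)] -/
theorem scaleIsolation (F : Type*) [Field F] [CharP F 2] (ω : F) (hω : ω ^ 2 + ω + 1 = 0)
    (z m D : ℕ) (a : Fin m → F) (w : Fin m → Fin z → ZMod 3) (ε : Bool) (b : Fin m)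
    (hmD : 2 * m * (D + 1) < 2 ^ D) (h3 : 3 ≤ (wsupp (w b)).card) (hA : mergedCoeff a w b ≠ 0)
    (hconst : ∃ κ : F, ∀ u ∈ parityCoset z ε, holoSum ω a w u = κ) :
    ∃ g : Fin m, w g ≠ w b ∧ mergedCoeff a w g ≠ 0 ∧ (wsupp (wout (w b) (w g))).card < D := by
  classical
  obtain ⟨κ, hκ⟩ := hconst
  -- two coins i₀ ≠ j₀ of w_b
  obtain ⟨i₀, hi₀, j₀, hj₀, hij⟩ : ∃ i₀ ∈ wsupp (w b), ∃ j₀ ∈ wsupp (w b), i₀ ≠ j₀ :=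
    Finset.one_lt_card.1 (by omega)
  have hbi : w b i₀ ≠ 0 := (mem_filter.1 hi₀).2
  have hbj : w b j₀ ≠ 0 := (mem_filter.1 hj₀).2
  -- test vectors: s_σ sign vector with s = w_b at i₀, j₀; v_σ = s_σ − w_b
  let pin : Finset (Fin z) := {i₀, j₀}
  let sv : (Fin z → Bool) → Fin z → ZMod 3 := fun σ i => if i ∈ pin then w b i else signVec σ i
  let tv : (Fin z → Bool) → Fin z → ZMod 3 := fun σ => sv σ - w b
  have hsv_ne : ∀ σ i, sv σ i ≠ 0 := by
    intro σ i
    simp only [sv]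
    split_ifs with h
    · simp only [pin, mem_insert, mem_singleton] at h
      rcases h with rfl | rfl
      · exact hbi
      · exact hbj
    · exact signVec_ne_zero σ i
  have htv_pin : ∀ σ, tv σ i₀ = 0 ∧ tv σ j₀ = 0 := by
    intro σ; simp [tv, sv, pin]
  -- the counted coordinates for the parity class of s_σ: E = complement of the pins
  let E : Finset (Fin z) := univ.filter fun i => i ∉ pin
  -- a third coordinate k₀ ∈ E (z ≥ |wsupp w_b| ≥ 3)
  obtain ⟨k₀, hk₀⟩ : ∃ k₀, k₀ ∈ E := by
    have hz3 : 3 ≤ (univ : Finset (Fin z)).card :=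
      le_trans h3 (card_le_card (subset_univ (wsupp (w b))))
    have hcardE : (univ : Finset (Fin z)).card ≤ E.card + pin.card := by
      calc (univ : Finset (Fin z)).card ≤ (E ∪ pin).card := card_le_card fun i _ => by
            by_cases h : i ∈ pin
            · exact mem_union_right _ h
            · exact mem_union_left _ (by simp [E, h])
        _ ≤ E.card + pin.card := card_union_le _ _
    have hpin : pin.card ≤ 2 := by
      simp only [pin]; exact (card_insert_le _ _).trans (by simp)
    have : 0 < E.card := by omega
    exact card_pos.1 this
  -- n₁(s_σ) = #{i ∈ E : σ i = false} + c_b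
  let cb : ℕ := (pin.filter fun i => w b i = 1).card
  have hn1 : ∀ σ, (univ.filter fun i => sv σ i = 1).card = (E.filter fun i => σ i = false).card + cb := by
    intro σ
    have hsplit : (univ.filter fun i => sv σ i = 1)
        = (E.filter fun i => σ i = false) ∪ (pin.filter fun i => w b i = 1) := by
      ext i
      simp only [mem_filter, mem_univ, true_and, mem_union, E, sv]
      by_cases hp : i ∈ pin
      · simp only [hp, ↓reduceIte, not_true_eq_false, false_and, false_or, true_and]
      · simp only [hp, ↓reduceIte, not_false_eq_true, true_and, false_and, or_false, signVec]
        cases σ i <;> simp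
        all_goals decide
    rw [hsplit, card_union_of_disjoint]
    rw [Finset.disjoint_left]
    intro i hi hi'
    exact (mem_filter.1 (mem_filter.1 hi).1).2 (mem_filter.1 hi').1
  -- Good patterns: (N) applies to s_σ
  set r : ℕ := (if ε then 1 else 0) + cb % 2 with hr
  set r' : ℕ := r % 2 with hr'
  let Good := univ.filter fun σ : Fin z → Bool => (E.filter fun i => σ i = false).card % 2 = r'
  have hGood : 2 ^ z ≤ 2 * Good.card :=
    two_pow_le_two_mul_card_parityOn E hk₀ r' (Nat.mod_lt _ (by norm_num))
  have hGoodN : ∀ σ ∈ Good, cosetCharSum ω z ε (sv σ) ≠ 0 := by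
    intro σ hσ
    have hz : 0 < z := Fin.pos i₀
    refine cosetCharSum_ne_zero hω ε (sv σ) hz (hsv_ne σ) ?_
    rcases Nat.even_or_odd z with _ | ho
    · right
      rw [hn1 σ]
      have hE := (mem_filter.1 hσ).2
      rw [Nat.add_mod, hE, hr', hr]
      cases ε <;> simp <;> omega
    · exact Or.inl ho
  -- Bad patterns for a class sticking out by ≥ D coordinates
  let Tfree : Fin m → Finset (Fin z) := fun g => E.filter fun i => w g i ≠ w b i
  let τ : Fin m → Fin z → Bool := fun g i => decide (w b i - w g i = 2)
  let Bad : Fin m → Finset (Fin z → Bool) := fun g =>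
    univ.filter fun σ => ((Tfree g).filter fun i => σ i = τ g i).card ≤ 1
  have hzero_iff : ∀ g σ i, i ∈ Tfree g → ((tv σ + w g) i = 0 ↔ σ i = τ g i) := by
    intro g σ i hi
    have hiE : i ∉ pin := (mem_filter.1 (mem_filter.1 hi).1).2
    have hne : w g i ≠ w b i := (mem_filter.1 hi).2
    simp only [tv, sv, Pi.add_apply, Pi.sub_apply, hiE, ↓reduceIte, τ, signVec]
    have hd : w b i - w g i ≠ 0 := sub_ne_zero.2 (Ne.symm hne)
    have : (w b i - w g i).val = 1 ∨ (w b i - w g i).val = 2 := by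
      have hl := (w b i - w g i).val_lt
      have h0 : (w b i - w g i).val ≠ 0 := fun h0 => hd ((ZMod.val_eq_zero _).1 h0)
      omega
    rcases this with h | h
    · have hδ : w b i - w g i = 1 := ZMod.val_injective 3 (by rw [h]; rfl)
      have : (if σ i = true then (2 : ZMod 3) else 1) - w b i + w g i = (if σ i = true then 2 else 1) - (w b i - w g i) := by ring
      rw [this, hδ]; cases σ i <;> simp
      all_goals decide
    · have hδ : w b i - w g i = 2 := ZMod.val_injective 3 (by rw [h]; rfl)
      have : (if σ i = true then (2 : ZMod 3) else 1) - w b i + w g i = (if σ i = true then 2 else 1) - (w b i - w g i) := by ring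
      rw [this, hδ]; cases σ i <;> simp
      all_goals decide
  -- a class sticking out by ≥ D coordinates has ≥ D free differing coordinates
  have hTfree : ∀ g, D ≤ (wsupp (wout (w b) (w g))).card → D ≤ (Tfree g).card := by
    intro g hd
    refine hd.trans (card_le_card fun i hi => ?_)
    have hi' := (mem_filter.1 hi).2
    simp only [wout] at hi'
    by_cases hb0 : w b i = 0
    · simp only [hb0, ↓reduceIte] at hi'
      have hip : i ∉ pin := by
        simp only [pin, mem_insert, mem_singleton]
        rintro (rfl | rfl)
        · exact hbi hb0
        · exact hbj hb0
      exact mem_filter.2 ⟨mem_filter.2 ⟨mem_univ _, hip⟩, by rw [hb0]; exact hi'⟩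
    · simp only [hb0, ↓reduceIte, ne_eq, not_true_eq_false] at hi'
  have hBad : ∀ g, D ≤ (wsupp (wout (w b) (w g))).card → (Bad g).card * 2 ^ D ≤ (D + 1) * 2 ^ z := by
    intro g hd
    have hK := hTfree g hd
    have hsz : (Tfree g).card ≤ z := by
      calc (Tfree g).card ≤ (univ : Finset (Fin z)).card := card_le_card (subset_univ _)
        _ = z := by rw [card_univ, Fintype.card_fin]
    have h1 := card_filter_agree_le_one_le (Tfree g) (τ g)
    have h2 := succ_mul_two_pow_sub_le (z := z) hK hsz
    have hDz : D ≤ z := hK.trans hsz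
    calc (Bad g).card * 2 ^ D ≤ (D + 1) * 2 ^ (z - D) * 2 ^ D := Nat.mul_le_mul_right _ (h1.trans h2)
      _ = (D + 1) * (2 ^ (z - D) * 2 ^ D) := by ring
      _ = (D + 1) * 2 ^ z := by rw [← pow_add, Nat.sub_add_cancel hDz]
  -- a good pattern outside every far bad set
  have hex : ∃ σ ∈ Good, ∀ g, D ≤ (wsupp (wout (w b) (w g))).card → σ ∉ Bad g := by
    by_contra hno
    push Not at hno
    have hsub : Good ⊆ (univ.filter fun g => D ≤ (wsupp (wout (w b) (w g))).card).biUnion Bad := by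
      intro σ hσ
      obtain ⟨g, hg, hσg⟩ := hno σ hσ
      exact mem_biUnion.2 ⟨g, by simp [hg], hσg⟩
    have hcard : Good.card * 2 ^ D ≤ m * ((D + 1) * 2 ^ z) := by
      calc Good.card * 2 ^ D
          ≤ ((univ.filter fun g => D ≤ (wsupp (wout (w b) (w g))).card).biUnion Bad).card * 2 ^ D :=
            Nat.mul_le_mul_right _ (card_le_card hsub)
        _ ≤ (∑ g ∈ univ.filter (fun g => D ≤ (wsupp (wout (w b) (w g))).card), (Bad g).card)
              * 2 ^ D := Nat.mul_le_mul_right _ card_biUnion_le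
        _ = ∑ g ∈ univ.filter (fun g => D ≤ (wsupp (wout (w b) (w g))).card),
              (Bad g).card * 2 ^ D := by rw [Finset.sum_mul]
        _ ≤ ∑ g ∈ univ.filter (fun g => D ≤ (wsupp (wout (w b) (w g))).card), (D + 1) * 2 ^ z :=
            sum_le_sum fun g hg => hBad g (mem_filter.1 hg).2
        _ ≤ ∑ _g : Fin m, (D + 1) * 2 ^ z :=
            sum_le_sum_of_subset_of_nonneg (filter_subset _ _) (fun _ _ _ => Nat.zero_le _)
        _ = m * ((D + 1) * 2 ^ z) := by rw [sum_const, card_univ, Fintype.card_fin, smul_eq_mul]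
    have : 2 ^ z * 2 ^ D < 2 ^ D * 2 ^ z := by
      calc 2 ^ z * 2 ^ D ≤ 2 * Good.card * 2 ^ D := Nat.mul_le_mul_right _ hGood
        _ = 2 * (Good.card * 2 ^ D) := by ring
        _ ≤ 2 * (m * ((D + 1) * 2 ^ z)) := Nat.mul_le_mul_left _ hcard
        _ = 2 * m * (D + 1) * 2 ^ z := by ring
        _ < 2 ^ D * 2 ^ z := Nat.mul_lt_mul_of_pos_right hmD (by positivity)
    rw [mul_comm] at this
    exact lt_irrefl _ this
  obtain ⟨σ, hσG, hσB⟩ := hex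
  -- the relation: (O) with v = tv σ, and Ŝ_ε(v) = 0 by (V)
  have hO := sum_cosetCharSum_add_eq hω a w hκ (tv σ)
  rw [cosetCharSum_eq_zero_of_two_zeros ω ε (tv σ) hij (htv_pin σ).1 (htv_pin σ).2, mul_zero] at hO
  -- classes sticking out by ≥ D die
  have hfar : ∀ g, D ≤ (wsupp (wout (w b) (w g))).card → cosetCharSum ω z ε (tv σ + w g) = 0 := by
    intro g hd
    have hnot := hσB g hd
    simp only [Bad, mem_filter, mem_univ, true_and, not_le] at hnot
    obtain ⟨i, hi, j, hj, hij'⟩ := Finset.one_lt_card.1 hnot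
    rw [mem_filter] at hi hj
    exact cosetCharSum_eq_zero_of_two_zeros ω ε _ hij' ((hzero_iff g σ i hi.1).2 hi.2)
      ((hzero_iff g σ j hj.1).2 hj.2)
  -- the class of b survives: tv σ + w b = sv σ
  have hself : cosetCharSum ω z ε (tv σ + w b) ≠ 0 := by
    have : tv σ + w b = sv σ := by funext i; simp [tv]
    rw [this]; exact hGoodN σ hσG
  by_contra hno
  push Not at hno
  rw [sum_eq_mergedCoeff_mul a w b (fun y => cosetCharSum ω z ε (tv σ + y)) ?_] at hO
  · exact mul_ne_zero hA hself hO
  · intro g hg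
    by_cases hAg : mergedCoeff a w g = 0
    · exact Or.inl hAg
    · right
      exact hfar g (hno g hg hAg)

/-! ### 11. Pin isolation (P-38z): `HoloIsolation` with structured near-neighbours -/

/-- **Pin isolation (P-38z; ROUND-34 §12.10(j)), typed `AffBells35.PinIsolation` verbatim.**  Centre row `b`, a
pin set `P` with a partial assignment `π` such that `π + w_b` is zero-free on `P`.  If every row with exponent
`≠ w_b` and non-zero merged coefficient is either DOUBLE-HIT by the pins (two coordinates of `P` where
`π + w_g = 0`) or differs from `w_b` in `≥ D` coordinates OUTSIDE `P`, then — under `8mD < 2^D`, `3 ≤ D`,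
`D + |P| ≤ |supp w_b|` and constancy of `R` on `H_ε` — the merged coefficient of `b` vanishes.  `P = ∅` is
`holoIsolation`.  Proof = `holoIsolation`'s counting on the sub-grid `v|_P = π`: pin `P ∪ {i₀, j₀}`
(`i₀ ≠ j₀ ∈ supp w_b ∖ P`, `v = 0` there), randomise the remaining signs; double-hit rows die for every
pattern, far rows outside at most `m(D−1)2^{z−D+2}` bad patterns, and more than half of all patterns make
`Ŝ_ε(s) ≠ 0`.
[cite: BarringtonStraubingTherien1990, §6 (the equidistribution/counting method behind it); statement and
proof supplied here (qa-qnc0 ROUND-34 §12.10(j))] -/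
theorem pinIsolation (F : Type*) [Field F] [CharP F 2] (ω : F) (hω : ω ^ 2 + ω + 1 = 0)
    (z m D : ℕ) (a : Fin m → F) (w : Fin m → Fin z → ZMod 3) (ε : Bool) (b : Fin m)
    (P : Finset (Fin z)) (π : Fin z → ZMod 3)
    (hmD : 8 * m * D < 2 ^ D) (hD3 : 3 ≤ D) (hDP : D + P.card ≤ (wsupp (w b)).card)
    (hπ : ∀ j ∈ P, π j + w b j ≠ 0)
    (hrows : ∀ g, w g ≠ w b → mergedCoeff a w g ≠ 0 →
        2 ≤ (P.filter fun j => π j + w g j = 0).card ∨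
        D ≤ ((univ \ P).filter fun j => w g j ≠ w b j).card)
    (hconst : ∃ κ : F, ∀ u ∈ parityCoset z ε, holoSum ω a w u = κ) :
    mergedCoeff a w b = 0 := by
  classical
  obtain ⟨κ, hκ⟩ := hconst
  -- D ≥ 6 (m ≥ 1 since b exists)
  have hm : 1 ≤ m := Nat.one_le_iff_ne_zero.2 fun h => by subst h; exact b.elim0
  have hD6 : 6 ≤ D := by
    refine six_le_of_eight_mul_lt (lt_of_le_of_lt ?_ hmD) (by omega)
    calc 8 * D = 8 * 1 * D := by ring
      _ ≤ 8 * m * D := Nat.mul_le_mul_right _ (Nat.mul_le_mul_left _ hm)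
  -- three distinct coins i₀, j₀, k₀ of w_b outside P
  have hSP : D ≤ (wsupp (w b) \ P).card := by
    have := le_card_sdiff P (wsupp (w b))
    omega
  obtain ⟨i₀, hi₀, j₀, hj₀, k₀, hk₀S, hij, hik, hjk⟩ :
      ∃ i₀ ∈ wsupp (w b) \ P, ∃ j₀ ∈ wsupp (w b) \ P, ∃ k₀ ∈ wsupp (w b) \ P,
        i₀ ≠ j₀ ∧ i₀ ≠ k₀ ∧ j₀ ≠ k₀ :=
    Finset.two_lt_card.1 (by omega)
  have hbi : w b i₀ ≠ 0 := (mem_filter.1 (mem_sdiff.1 hi₀).1).2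
  have hbj : w b j₀ ≠ 0 := (mem_filter.1 (mem_sdiff.1 hj₀).1).2
  have hiP : i₀ ∉ P := (mem_sdiff.1 hi₀).2
  have hjP : j₀ ∉ P := (mem_sdiff.1 hj₀).2
  have hkP : k₀ ∉ P := (mem_sdiff.1 hk₀S).2
  -- test vectors: s_σ = sign vector with s = w_b at i₀, j₀, s = π + w_b on P; v_σ = s_σ − w_b
  let pin : Finset (Fin z) := insert i₀ (insert j₀ P)
  let fix : Fin z → ZMod 3 := fun i => if i ∈ P then π i + w b i else w b i
  let sv : (Fin z → Bool) → Fin z → ZMod 3 := fun σ i => if i ∈ pin then fix i else signVec σ i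
  let tv : (Fin z → Bool) → Fin z → ZMod 3 := fun σ => sv σ - w b
  have hsv_ne : ∀ σ i, sv σ i ≠ 0 := by
    intro σ i
    simp only [sv, fix]
    split_ifs with h hP
    · exact hπ i hP
    · simp only [pin, mem_insert] at h
      rcases h with rfl | rfl | h
      · exact hbi
      · exact hbj
      · exact absurd h hP
    · exact signVec_ne_zero σ i
  have htv_pin : ∀ σ, tv σ i₀ = 0 ∧ tv σ j₀ = 0 := by
    intro σ; simp [tv, sv, pin, fix, hiP, hjP]
  have htv_P : ∀ σ, ∀ j ∈ P, tv σ j = π j := by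
    intro σ j hj
    have : j ∈ pin := by simp [pin, hj]
    simp [tv, sv, this, fix, hj]
  -- the counted coordinates for the parity class of s_σ: E = complement of the pins
  let E : Finset (Fin z) := univ.filter fun i => i ∉ pin
  have hk₀ : k₀ ∈ E := by
    refine mem_filter.2 ⟨mem_univ _, ?_⟩
    simp only [pin, mem_insert, not_or]
    exact ⟨Ne.symm hik, Ne.symm hjk, hkP⟩
  -- n₁(s_σ) = #{i ∈ E : σ i = false} + c_b
  let cb : ℕ := (pin.filter fun i => fix i = 1).card
  have hn1 : ∀ σ, (univ.filter fun i => sv σ i = 1).card = (E.filter fun i => σ i = false).card + cb := by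
    intro σ
    have hsplit : (univ.filter fun i => sv σ i = 1)
        = (E.filter fun i => σ i = false) ∪ (pin.filter fun i => fix i = 1) := by
      ext i
      simp only [mem_filter, mem_univ, true_and, mem_union, E, sv]
      by_cases hp : i ∈ pin
      · simp only [hp, ↓reduceIte, not_true_eq_false, false_and, false_or, true_and]
      · simp only [hp, ↓reduceIte, not_false_eq_true, true_and, false_and, or_false, signVec]
        cases σ i <;> simp
        all_goals decide
    rw [hsplit, card_union_of_disjoint]
    rw [Finset.disjoint_left]
    intro i hi hi'
    exact (mem_filter.1 (mem_filter.1 hi).1).2 (mem_filter.1 hi').1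
  -- Good patterns: (N) applies to s_σ
  set r : ℕ := (if ε then 1 else 0) + cb % 2 with hr
  set r' : ℕ := r % 2 with hr'
  let Good := univ.filter fun σ : Fin z → Bool => (E.filter fun i => σ i = false).card % 2 = r'
  have hGood : 2 ^ z ≤ 2 * Good.card :=
    two_pow_le_two_mul_card_parityOn E hk₀ r' (Nat.mod_lt _ (by norm_num))
  have hGoodN : ∀ σ ∈ Good, cosetCharSum ω z ε (sv σ) ≠ 0 := by
    intro σ hσ
    have hz : 0 < z := Fin.pos i₀
    refine cosetCharSum_ne_zero hω ε (sv σ) hz (hsv_ne σ) ?_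
    rcases Nat.even_or_odd z with _ | ho
    · right
      rw [hn1 σ]
      have hE := (mem_filter.1 hσ).2
      rw [Nat.add_mod, hE, hr', hr]
      cases ε <;> simp <;> omega
    · exact Or.inl ho
  -- Bad patterns for a far class
  let Far : Fin m → Prop := fun g => D ≤ ((univ \ P).filter fun j => w g j ≠ w b j).card
  let Tfree : Fin m → Finset (Fin z) := fun g => E.filter fun i => w g i ≠ w b i
  let τ : Fin m → Fin z → Bool := fun g i => decide (w b i - w g i = 2)
  let Bad : Fin m → Finset (Fin z → Bool) := fun g =>
    univ.filter fun σ => ((Tfree g).filter fun i => σ i = τ g i).card ≤ 1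
  have hzero_iff : ∀ g σ i, i ∈ Tfree g → ((tv σ + w g) i = 0 ↔ σ i = τ g i) := by
    intro g σ i hi
    have hiE : i ∉ pin := (mem_filter.1 (mem_filter.1 hi).1).2
    have hne : w g i ≠ w b i := (mem_filter.1 hi).2
    simp only [tv, sv, Pi.add_apply, Pi.sub_apply, hiE, ↓reduceIte, τ, signVec]
    have hd : w b i - w g i ≠ 0 := sub_ne_zero.2 (Ne.symm hne)
    have : (w b i - w g i).val = 1 ∨ (w b i - w g i).val = 2 := by
      have hl := (w b i - w g i).val_lt
      have h0 : (w b i - w g i).val ≠ 0 := fun h0 => hd ((ZMod.val_eq_zero _).1 h0)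
      omega
    rcases this with h | h
    · have hδ : w b i - w g i = 1 := ZMod.val_injective 3 (by rw [h]; rfl)
      have : (if σ i = true then (2 : ZMod 3) else 1) - w b i + w g i = (if σ i = true then 2 else 1) - (w b i - w g i) := by ring
      rw [this, hδ]; cases σ i <;> simp
      all_goals decide
    · have hδ : w b i - w g i = 2 := ZMod.val_injective 3 (by rw [h]; rfl)
      have : (if σ i = true then (2 : ZMod 3) else 1) - w b i + w g i = (if σ i = true then 2 else 1) - (w b i - w g i) := by ring
      rw [this, hδ]; cases σ i <;> simp
      all_goals decide
  -- far classes have many free differing coordinates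
  have hTfree : ∀ g, Far g → D - 2 ≤ (Tfree g).card := by
    intro g hd
    have hsub : ((univ \ P).filter fun j => w g j ≠ w b j) ⊆ Tfree g ∪ {i₀, j₀} := by
      intro i hi
      have hiP' : i ∉ P := (mem_sdiff.1 (mem_filter.1 hi).1).2
      by_cases hp : i ∈ pin
      · simp only [pin, mem_insert] at hp
        rcases hp with rfl | rfl | hp
        · exact mem_union_right _ (by simp)
        · exact mem_union_right _ (by simp)
        · exact absurd hp hiP'
      · exact mem_union_left _ (mem_filter.2 ⟨mem_filter.2 ⟨mem_univ _, hp⟩, (mem_filter.1 hi).2⟩)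
    have hpin : ({i₀, j₀} : Finset (Fin z)).card ≤ 2 := (card_insert_le _ _).trans (by simp)
    have := (card_le_card hsub).trans (card_union_le _ _)
    simp only [Far] at hd
    omega
  have hBad : ∀ g, Far g → (Bad g).card * 2 ^ D ≤ (D - 1) * 2 ^ 2 * 2 ^ z := by
    intro g hd
    have hK := hTfree g hd
    have hsz : (Tfree g).card ≤ z := by
      calc (Tfree g).card ≤ (univ : Finset (Fin z)).card := card_le_card (subset_univ _)
        _ = z := by rw [card_univ, Fintype.card_fin]
    have h1 := card_filter_agree_le_one_le (Tfree g) (τ g)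
    have h2 := succ_mul_two_pow_sub_le (z := z) hK hsz
    have hKz : D - 2 ≤ z := hK.trans hsz
    have hD2 : D - 2 + 1 = D - 1 := by omega
    calc (Bad g).card * 2 ^ D ≤ (D - 2 + 1) * 2 ^ (z - (D - 2)) * 2 ^ D := Nat.mul_le_mul_right _ (h1.trans h2)
      _ = (D - 1) * (2 ^ (z - (D - 2)) * 2 ^ (D - 2)) * 2 ^ 2 := by
          rw [hD2, show (2 : ℕ) ^ D = 2 ^ (D - 2) * 2 ^ 2 by rw [← pow_add]; congr 1; omega]; ring
      _ = (D - 1) * 2 ^ z * 2 ^ 2 := by rw [← pow_add, Nat.sub_add_cancel hKz]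
      _ = (D - 1) * 2 ^ 2 * 2 ^ z := by ring
  -- a good pattern outside every far bad set
  have hex : ∃ σ ∈ Good, ∀ g, Far g → σ ∉ Bad g := by
    by_contra hno
    push Not at hno
    have hsub : Good ⊆ (univ.filter fun g => Far g).biUnion Bad := by
      intro σ hσ
      obtain ⟨g, hg, hσg⟩ := hno σ hσ
      exact mem_biUnion.2 ⟨g, by simp [hg], hσg⟩
    have hcard : Good.card * 2 ^ D ≤ m * ((D - 1) * 2 ^ 2 * 2 ^ z) := by
      calc Good.card * 2 ^ D
          ≤ ((univ.filter fun g => Far g).biUnion Bad).card * 2 ^ D :=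
            Nat.mul_le_mul_right _ (card_le_card hsub)
        _ ≤ (∑ g ∈ univ.filter (fun g => Far g), (Bad g).card) * 2 ^ D :=
            Nat.mul_le_mul_right _ card_biUnion_le
        _ = ∑ g ∈ univ.filter (fun g => Far g), (Bad g).card * 2 ^ D := by
            rw [Finset.sum_mul]
        _ ≤ ∑ g ∈ univ.filter (fun g => Far g), (D - 1) * 2 ^ 2 * 2 ^ z :=
            sum_le_sum fun g hg => hBad g (mem_filter.1 hg).2
        _ ≤ ∑ _g : Fin m, (D - 1) * 2 ^ 2 * 2 ^ z :=
            sum_le_sum_of_subset_of_nonneg (filter_subset _ _) (fun _ _ _ => Nat.zero_le _)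
        _ = m * ((D - 1) * 2 ^ 2 * 2 ^ z) := by rw [sum_const, card_univ, Fintype.card_fin, smul_eq_mul]
    have hDm1 : 8 * m * (D - 1) < 2 ^ D := lt_of_le_of_lt (Nat.mul_le_mul_left _ (Nat.sub_le _ _)) hmD
    have : 2 ^ z * 2 ^ D < 2 ^ D * 2 ^ z := by
      calc 2 ^ z * 2 ^ D ≤ 2 * Good.card * 2 ^ D := Nat.mul_le_mul_right _ hGood
        _ = 2 * (Good.card * 2 ^ D) := by ring
        _ ≤ 2 * (m * ((D - 1) * 2 ^ 2 * 2 ^ z)) := Nat.mul_le_mul_left _ hcard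
        _ = 8 * m * (D - 1) * 2 ^ z := by ring
        _ < 2 ^ D * 2 ^ z := Nat.mul_lt_mul_of_pos_right hDm1 (by positivity)
    rw [mul_comm] at this
    exact lt_irrefl _ this
  obtain ⟨σ, hσG, hσB⟩ := hex
  -- the relation: (O) with v = tv σ, and Ŝ_ε(v) = 0 by (V)
  have hO := sum_cosetCharSum_add_eq hω a w hκ (tv σ)
  rw [cosetCharSum_eq_zero_of_two_zeros ω ε (tv σ) hij (htv_pin σ).1 (htv_pin σ).2, mul_zero] at hO
  -- far classes die
  have hfar : ∀ g, Far g → cosetCharSum ω z ε (tv σ + w g) = 0 := by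
    intro g hd
    have hnot := hσB g hd
    simp only [Bad, mem_filter, mem_univ, true_and, not_le] at hnot
    obtain ⟨i, hi, j, hj, hij'⟩ := Finset.one_lt_card.1 hnot
    rw [mem_filter] at hi hj
    exact cosetCharSum_eq_zero_of_two_zeros ω ε _ hij' ((hzero_iff g σ i hi.1).2 hi.2)
      ((hzero_iff g σ j hj.1).2 hj.2)
  -- double-hit classes die for every pattern
  have hhit : ∀ g, 2 ≤ (P.filter fun j => π j + w g j = 0).card →
      cosetCharSum ω z ε (tv σ + w g) = 0 := by
    intro g h2
    obtain ⟨i, hi, j, hj, hij'⟩ := Finset.one_lt_card.1 (by omega : 1 < (P.filter fun j => π j + w g j = 0).card)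
    rw [mem_filter] at hi hj
    have hzi : (tv σ + w g) i = 0 := by rw [Pi.add_apply, htv_P σ i hi.1]; exact hi.2
    have hzj : (tv σ + w g) j = 0 := by rw [Pi.add_apply, htv_P σ j hj.1]; exact hj.2
    exact cosetCharSum_eq_zero_of_two_zeros ω ε _ hij' hzi hzj
  -- the class of b survives: tv σ + w b = sv σ
  have hself : cosetCharSum ω z ε (tv σ + w b) ≠ 0 := by
    have : tv σ + w b = sv σ := by funext i; simp [tv]
    rw [this]; exact hGoodN σ hσG
  rw [sum_eq_mergedCoeff_mul a w b (fun y => cosetCharSum ω z ε (tv σ + y)) ?_] at hO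
  · exact (mul_eq_zero.1 hO).resolve_right hself
  · intro g hg
    by_cases hAg : mergedCoeff a w g = 0
    · exact Or.inl hAg
    · right
      rcases hrows g hg hAg with h2 | hd
      · exact hhit g h2
      · exact hfar g hd

end CosetFourier

end Literature.Computability.MetaComplexity
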